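import Summits.BirchSwinnertonDyer.BirchSwinnertonDyer.Theorems.InertBadSignedBranchesCccOneOfKMCImpReading
import Literature.NumberTheory.EllipticCurves.Kato2004.PerrinRiouRatio
import Summits.BirchSwinnertonDyer.Rank1Residual.Additive.KatoDescentClosedBindersContra
import Summits.BirchSwinnertonDyer.Rank1Residual.Additive.KatoDescentKMCImpReadingRowRealizable
import Summits.BirchSwinnertonDyer.Rank1Residual.Additive.KatoDescentRankOneCountRowsOfLoc
import Summits.BirchSwinnertonDyer.Rank1Residual.Additive.KatoDescentRealizableContraRankOne
import Summits.BirchSwinnertonDyer.Rank1Residual.Additive.KatoDescentAdmissibleIstarZero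
import Literature.NumberTheory.EllipticCurves.Kato2004.AdmissibleZetaClassRealisabilityCM
import Literature.NumberTheory.EllipticCurves.Kato2004.KatoMainConjectureCMOffMu
import Summits.BirchSwinnertonDyer.Rank1Residual.Additive.KatoDescentLengthEqualityOffMuIstarZero
import Summits.BirchSwinnertonDyer.Rank1Residual.Additive.KatoDescentKMCImpReadingIstarKFormReal
import Summits.BirchSwinnertonDyer.BirchSwinnertonDyer.Theorems.InertBadSignedBranchesCccOneLawOnTypeIstarZeroCollinearMuRows
import Summits.BirchSwinnertonDyer.BirchSwinnertonDyer.Theorems.InertBadSignedBranchesCccOneLawOnTypeIstarZeroAdmissiblePackage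
import Summits.BirchSwinnertonDyer.BirchSwinnertonDyer.Theorems.InertBadSignedBranchesCccOneLawOnTypeIstarZeroPerrinRiouSplit
import Summits.BirchSwinnertonDyer.BirchSwinnertonDyer.Theorems.InertBadSignedBranchesCccOneLawOnTypeIstarZeroHasPRRatio
import Summits.BirchSwinnertonDyer.BirchSwinnertonDyer.Theorems.InertBadSignedBranchesCccOneLawOnTypeIstarZeroPerrinRiouOfValuation
import Summits.BirchSwinnertonDyer.Rank1Residual.Additive.InertBadSignedBranchesCccOneLawOnTypeIstarZeroZetaLinesProportionalOfColPlusInterpolationCoherent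
import HarnessLib

set_option linter.dupNamespace false
set_option autoImplicit false

/-!
# Skeleton line `kato-perrin-riou-istar` on crux `CccOneLawOnTypeIstarZero` (stmt-BirchSwinnertonDyer-19223),
# route `InertBadSignedBranches` (K8) — v18 = SIX stubs: TWO RESEARCH {the Perrin-Riou VALUATION identity (VAL) of every Kato ratio on the rows =
# stub 1b′ (parked); the twist exponent identity «a = b» = stub 2c-T2} + ONE [C]-BOOKKEEPING {hC″ = the PER-LEVEL twist/period scalar value
# identity in the ι-STANDARD frame = stub 2c-T1″ `stub_twistScalarIstarZeroStd` (NEW; WEAKER than v12–v17's 2c-T1)} + ONE ROUTE-CRUX {`PlusMCEtaK` =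
# item 19501} + TWO PURE-CITE {ten named facts / fact items; `SignedReadingFacts` ∧ GZK} — v12–v17's PRINT-BY-PROOF stub 2c-T1 (the
# `ℚ_pˣ·Λˣ`-proportionality of the two zeta lines) RESHAPED by rule (ii) to its ONE kernel residue hC″ via the F1″ closer p838712 fed with the
# NINTH [A′] (p837519) and TENTH [C-align] (p837332) print conjuncts (planner bsd-cm-plan g41,
# 2026-09-01, D1225; v17 = 1c7e623d6cf61178 (the tree file before this commit; g40, D1212 = the director-ordered REVERT of v16 to the v15 bytes,
# (993)(a)(ii)); v16 = 729c81388782d277 (g40, D1210; WITHDRAWN — zeta-frame defect, critic NOTE #66, pen D1211); v15 = 1c7e623d6cf61178 (g40, D1186 = the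
# rule-(ii) shrink of stub 1b by p831315); v14 = d28dea3752b9af4a (g40, D1185 = stub 1a closed in-file by p831109); v13 = e3781ce8aaf94304 (g40, D1177 =
# the rule-(ii) split of stub 1); v12 = b9ec5fd877de5f89 (g40, D1176 = the PRINT ∣ RESEARCH split of stub 2c); v11 = d5290a4395abfc6e (g39, D1154);
# v10 = c297a62d26ae381b (g32, D761 = (a), the (T22) correction); v9 = 38d418e272178ba0 (g32, D748 (3)/D751); v8 = 8afa38de3d705f2b (D743 (2)/D748 =
# the (T20) split); v7 = 44679c3463c1cc8d (g32, D724/D725/D729 = the (T19) split); v6 = 912f1f77349a4b85 (planner g31, D692/D699/D707, the (T17)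
# touch); v5 = 7ed0244c9dc81658 (D679 (1) under director-bsd RESTUB SHAPE OF RECORD HOME/INBOX.md l.236); v4 = 447571ee46303522, FIVE stubs, planner
# g27 D410).

WHAT CHANGED vs v17 (v17 ≡ v15 BYTES; v18 = the RULE-(ii) RESHAPE of PRINT-BY-PROOF stub 2c-T1 along the RE-TYPED COMPOSITION of director-bsd
(993)(a)(iii) — the re-typing docket (T1)(T2)(T3) of the typer k-ty1 g40 that REPLACES the withdrawn v16 road ([A] p834027 `exists_colPlusInterpolation`
+ F1 p835994 + hC in Lean's per-level `IsCyclotomicExtension.zeta` frame: FRAME DEFECT, critic NOTE #66 / `pub/ideators/idea-crit-15/K8-FRAME-DEFECT.md`,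
pen D1211, v17 = the director-ordered revert D1212; [A] stays QUARANTINED — never a conjunct, never a consumer; F1 stays accepted-unconsumed):
(T1) [A′] p837519 `Literature/NumberTheory/EllipticCurves/Kobayashi2003/EtaColemanInterpolationCoherent.lean` (fd3bc62287aedb61; named PRINT fact
`Kobayashi2003.exists_colPlusInterpolationCoherent`: Kobayashi 2003 Cor. 8.20 ∘ Prop. 8.25 ∘ (8.29) ∘ Prop. 8.26 read in ONE norm-coherent root system —
the plus Coleman map interpolates the `exp*`-character sums of EVERY class at the characters of `p`-power order and even level, Gauss sums
`padicGaussSumAt … (μ n) …` at a root system `μ` on which the `p`-adic embeddings are tame-coherent (`IsCoherentPadicEmbeddings`), `∃ (lam : ℂ_[p])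
(u : (IwasawaAlgebra p)ˣ)` = one global scalar AND one `Λ`-unit (pen D1214 (E1), critic NOTE #70); pre-reads pen D1215 / critic NOTE #71–#72 / host eis
l.8295–8297); (T2) [C-align] p837332 `Literature/NumberTheory/EllipticCurves/Kato2004/ExpStarCorestrictionRootSystem.lean` (d34bac4721723eba; named PRINT
fact `Kato2004.exists_traceCoherentRootSystem_of_definedExpStarBody`: Kato 2004 Thm. 12.5 / (C1)(C4) — a (DEF)-datum's `exp*`-frame carries a
TRACE-COHERENT root system `IsTraceCoherentRootSystem W p Λ μ`); (T3) W2 p838339 `Literature/NumberTheory/EllipticCurves/Kato2004/FrameOffsetDescent.lean`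
(72d45e92045a8ac2, 910 l., THEOREMS ONLY, debt 0: frame-offset descent — trace coherence + (C1)/(C4)/(C5) + Fourier inversion + Rohrlich-at-level
`PSRohrlichAtLevel.rohrlich_primePow_of_isNewformOf` ⇒ the offsets between the ι-standard roots and the trace-coherent roots are coherent beyond a
level n₁; `exists_isCoherentPadicEmbeddings`), the F1″-unit p838505 and the KERNEL CLOSER F1″ p838712
`Summits/BirchSwinnertonDyer/Rank1Residual/Additive/InertBadSignedBranchesCccOneLawOnTypeIstarZeroZetaLinesProportionalOfColPlusInterpolationCoherent.lean`
(161eb093191c514d, 380 l.): `CccOneZetaLinesCoherent.stub2cT1_of_colPlusInterpolationCoherent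
(hA′ : Kobayashi2003.exists_colPlusInterpolationCoherent) (hCal : Kato2004.exists_traceCoherentRootSystem_of_definedExpStarBody)
(hFCM : Kato2004.exists_isAdmissibleZetaClass_of_hasCM_of_irreducible) (hC″ : <text>) : <TYPE OF v12–v17's STUB 2c-T1 VERBATIM>` (Additive lane; the
Φ-trick `(1+T)^{p^{n₁}} − 1` feeds (W1) p835629 `IwasawaAlgebra.exists_pow_smul_eq_of_values_proportional` as is).  hC″ — the PER-LEVEL twist/period
SCALAR comparison of the two finite-layer value laws in the ι-STANDARD frame (roots `ρ n` pinned by the datum's OWN complex family `ι`: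
`ι _ (ρ n) = exp(2πi/p^{n+1})`; `p`-adic embeddings tame-coherent on `ρ`; Gauss sums `padicGaussSumAt … (ρ n) …`; ONE constant `C′`, ONE `Λ`-unit `w`;
no cross-level content) — is the closer's ONE named residue and did NOT close in kernel (pen ruling D1216: the registered residue is hC″, decl name
`stub_twistScalarIstarZeroStd`; the TRACE-frame variant hC′ is NOT registered).  By director RESTUB rule (ii) stub 2c-T1 is RESHAPED to that residue:
NEW [C]-BOOKKEEPING stub 2c-T1″ `stub_twistScalarIstarZeroStd` = hC″ VERBATIM (text sha16 83c7d02d2ecdef61; strictly WEAKER than 2c-T1: 2c-T1 follows from it +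
[A′] + [C-align] + F-CM by p838712), and v12–v17's `stub_zetaLinesProportionalIstarZero` becomes the sorry-free `zetaLinesProportionalIstarZero_closed`
(TYPE VERBATIM = v17 l.380–397, 385 tokens), MOVED below `hasPRRatioIstarZero_closed` (declaration order: it reads PRINT stub 5), read by name by its one
in-file consumer `muColPlusAdmissibleIstarZero_closed`.  PRINT stub 5 `stub_printFactsKato` GAINS the NINTH conjunct [A′]
`Kobayashi2003.exists_colPlusInterpolationCoherent` (path `.2.2.2.2.2.2.2.2.1`) and the TENTH [C-align] `Kato2004.exists_traceCoherentRootSystem_of_definedExpStarBody`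
(path `.2.2.2.2.2.2.2.2.2`), appended LAST (the line's named-fact ledger 8 → 10; tree debt unchanged by THIS file: the +1's were booked at p837519 /
p837332, pen D1217); the ONE projection path of conjunct 8 (★ `Kato2004.exists_zetaClassPosition_of_rank_le_one`) in `muColPlusAdmissibleIstarZero_closed`
becomes `.2.2.2.2.2.2.2.1`; hFCM = conjunct 3 at `.2.2.1` unchanged.  Stubs 1b′, 2c-T2, 6a, 6b, `hasPRRatioIstarZero_closed`, `katoMuEqualityIstarZero_closed`,
`lengthEq_closed`, `kmcFine_closed`, `perrinRiouRatioIstarZero_closed`, `rowCount_closed`, `realizable_closed` and the composition head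
`CccOneLawOnTypeIstarZero_of` are BYTE-IDENTICAL to v17.  COUNT: 6 → 6 registered stubs (one PRINT-BY-PROOF stub replaced by a WEAKER per-level
[C]-BOOKKEEPING stub, rule (ii)); honest label «2c-T1 closed MODULO PRINT ([A′], [C-align], F-CM) + ONE per-level bookkeeping stub» — 2c-T1's unproved
content is now 2c-T1″; 19223 OPEN.  v16's zeta-frame stub `stub_twistScalarIstarZero` (729c81388782d277) is NOT this stub and is never re-registered.
Registered stubs after this file: `stub_perrinRiouValuationIstarZero` (RESEARCH, parked), `stub_twistScalarIstarZeroStd` ([C]-BOOKKEEPING, new — per-level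
class-free value identity, typing debt over tree objects; hand of record ibsb-9 (p836061/p836259 road, offset k = 1 under ι)), `stub_twistExponentEqIstarZero`
(RESEARCH), `stub_printFactsKato` (PURE-CITE, ten), `stub_plusMCEtaK` (ROUTE CRUX 19501), `stub_printInputsInert` (PURE-CITE).

WHAT CHANGED vs v14 (v15 = the RULE-(ii) SHRINK of RESEARCH stub 1b made possible by refill hand `leafhand-bsd-inertbadsignedbran-7` g0's second def-free
landing `--supports 19223` p831315 `Theorems/InertBadSignedBranchesCccOneLawOnTypeIstarZeroPerrinRiouOfValuation.lean` (38062df9d6bff5fa, 118 l., 2 theorems;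
REPORT-AND-STOP 2026-08-31T18:58:20Z, bsd-cm INBOX l.505; the hand's own candidate `kato_perrin_riou_istar.v14-candidate.lean` 42b10d11bf9fe53f = evidence #59):
`CccOneHasPRRatio.perrinRiouNonvanishingIstarZero_of_kmcFineContra (hloc : Kato2004.exists_iwasawaH2Data_fineSelmerDual_embedding_loc)
(hmod : ModularForms.exists_isNewformOf) (hGZK : rank_eq_analyticRank_of_analyticRank_le_one) : ∀ p ≥ 5, ∀ W on the type at analytic rank one,
KatoMainConjectureFineContra W p → ∀ ℒ, Kato2004.PRRatio W p ℒ → ℒ ≠ 0` — KERNEL: a Kato descent datum of the contragredient key is realised on the row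
(H2X′ + GZK), the count reading gives `(𝐇²)_Γ` finite and `ℒ ≠ 0 ↔ [A : z] ≠ 0`, and Conj. 12.10 for the datum gives `[A : z] = #(𝐇²)_Γ ≥ 1`; on this
line Conj. 12.10 on the rows IS the sorry-free `kmcFine_closed` (F-CM + `lengthEq_closed`, v7–v13).  So the (NV) half of v13's RESEARCH stub 1b
`stub_perrinRiouLawIstarZero` is print-by-proof from the line's other stubs, and by director RESTUB rule (ii) the stub SHRINKS to its research content:
NEW RESEARCH stub 1b′ `stub_perrinRiouValuationIstarZero` = (VAL) alone (same binders; the second conjunct of v13's 1b VERBATIM).  v13's 1b LEAVES the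
registered set (it is 1b′ ∧ a theorem).  `perrinRiouRatioIstarZero_closed` (TYPE VERBATIM = v4–v12's stub 1) MOVES below `kmcFine_closed` and now reads
`….mpr ⟨hasPRRatioIstarZero_closed, (NV) := perrinRiouNonvanishingIstarZero_of_kmcFineContra printFacts.1 printFacts.2.1 printInputs.2 … (kmcFine_closed …),
stub_perrinRiouValuationIstarZero⟩`.  NAMED-FACT DEBT of the line UNCHANGED (H2X′ = conjunct 1, modularity = conjunct 2, F-CM = conjunct 3 of PRINT stub 5;
GZK = conjunct 2 of stub 6b); tree debt +0.  Stubs 2c-T1, 2c-T2, 5, 6a, 6b, `hasPRRatioIstarZero_closed`, `muColPlusAdmissibleIstarZero_closed`,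
`katoMuEqualityIstarZero_closed`, `lengthEq_closed`, `kmcFine_closed`, `rowCount_closed`, `realizable_closed` and the composition head
`CccOneLawOnTypeIstarZero_of` are BYTE-IDENTICAL to v14.  Registered stubs after this file: `stub_perrinRiouValuationIstarZero` (RESEARCH),
`stub_zetaLinesProportionalIstarZero` (PRINT-BY-PROOF), `stub_twistExponentEqIstarZero` (RESEARCH), `stub_printFactsKato` (PURE-CITE, eight), `stub_plusMCEtaK`
(ROUTE CRUX 19501), `stub_printInputsInert` (PURE-CITE).

WHAT CHANGED vs v13 (v14 = the IN-FILE CLOSE of PRINT-BY-PROOF stub 1a reported by refill hand `leafhand-bsd-inertbadsignedbran-7` g0 (REPORT-AND-STOP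
2026-08-31T18:58:20Z, bsd-cm INBOX l.505; census `CENSUS-19223-leafhand-7-g0.md` bcea860ece0be7d5, evidence #58 on 19223) and ruled GO by director-bsd
(913)(b) «stub 1a closed in-file by `hasPRRatioIstarZero_of_facts stub_printFactsKato.2.2.1 stub_printInputsInert.2` (p831109), 7 → 6 stubs, `_of`
unchanged, nothing else in the delta»): the hand's def-free landing `--supports 19223` p831109
`Theorems/InertBadSignedBranchesCccOneLawOnTypeIstarZeroHasPRRatio.lean` (91bd5da23aa8fc6e, 199 l., 6 theorems) proves
`CccOneHasPRRatio.hasPRRatioIstarZero_of_facts (hFCM : Kato2004.exists_isAdmissibleZetaClass_of_hasCM_of_irreducible)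
(hGZK : rank_eq_analyticRank_of_analyticRank_le_one) : <TYPE OF v13's STUB 1a VERBATIM>` — KERNEL: the shared pin `Kato2004.AdmissibleZetaClassBody`
(A0)–(A4) IS `Kato2004.PRRatioBody` (Z0)–(Z5) verbatim plus the (A6′) `perRatio`, so an admissible Kato class on a cyclotomic pin (F-CM on the type:
`W` has CM and `W[p]` is irreducible, `ω₂` on inertia) carries a Perrin-Riou ratio once the Kummer logarithm line is supplied by the tree theorem
`LocPKummer.logEx_of_gzk` and the generator by Mordell–Weil at rank one (GZK).  v13's stub 1a `stub_hasPRRatioIstarZero` LEAVES the registered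
set: its statement is now the sorry-free `hasPRRatioIstarZero_closed` (TYPE VERBATIM, placed below PRINT stub 6b whose `.2` it consumes), :=
`CccOneHasPRRatio.hasPRRatioIstarZero_of_facts stub_printFactsKato.2.2.1 stub_printInputsInert.2`; the sorry-free `perrinRiouRatioIstarZero_closed`
reads `hasPRRatioIstarZero_closed` where v13 read stub 1a (one token).  NAMED-FACT DEBT of the line UNCHANGED (F-CM was already conjunct 3 of PRINT
stub 5; GZK already conjunct 2 of PRINT stub 6b); tree debt +0.  Stubs 1b, 2c-T1, 2c-T2, 5, 6a, 6b, `muColPlusAdmissibleIstarZero_closed`,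
`katoMuEqualityIstarZero_closed`, `lengthEq_closed`, `kmcFine_closed`, `rowCount_closed`, `realizable_closed` and the composition head
`CccOneLawOnTypeIstarZero_of` are BYTE-IDENTICAL to v13.  NOT in this delta (director (913)(b): «optional 1b→(VAL) shrink = second delta, pen's
call»): the hand's second landing p831315 `Theorems/…IstarZeroPerrinRiouOfValuation.lean` ((NV) ⟸ `kmcFine_closed` + H2X′ + modularity + GZK)
would let RESEARCH stub 1b shrink to its (VAL) conjunct; booked for a v15 touch after the critic's cert of this file.  Registered stubs after this
file: `stub_perrinRiouLawIstarZero` (RESEARCH), `stub_zetaLinesProportionalIstarZero` (PRINT-BY-PROOF), `stub_twistExponentEqIstarZero` (RESEARCH),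
`stub_printFactsKato` (PURE-CITE, eight), `stub_plusMCEtaK` (ROUTE CRUX 19501), `stub_printInputsInert` (PURE-CITE).

WHAT CHANGED vs v12 (v13 = the RULE-(ii) SPLIT of research stub 1 suggested by refill hand `leafhand-bsd-inertbadsignedbran-6` g0 (ADDENDUM 2026-08-31T17:22Z,
bsd-cm INBOX l.495; census v5 6582ddbfeb2b2d47) and made possible by its third def-free landing `--supports 19223` p829671
`Theorems/InertBadSignedBranchesCccOneLawOnTypeIstarZeroPerrinRiouSplit.lean`: `CccOnePerrinRiouSplit.perrinRiouUpToUnitAt_iff_exists_and_forall_onType_IstarZero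
(hmod : exists_isNewformOf) (hGZK : rank_eq_analyticRank_of_analyticRank_le_one) : <TYPE OF STUB 1 VERBATIM> ↔ (E) ∧ (NV) ∧ (VAL)` through the tree
THEOREM PR-INV `PerrinRiouUnit.prInv_of_modularity_of_rankOne` (any two Perrin-Riou ratios of `(W, p)` differ by a norm-one factor at rank one).
v4–v12's RESEARCH stub 1 `stub_perrinRiouRatioIstarZero` (`PerrinRiouUpToUnitAt Kato2004.PRRatio W p` on the rows, which MIXES a print-by-proof
existence clause with the research content — director RESTUB rule (ii)) LEAVES the registered set: its statement is now the sorry-free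
`perrinRiouRatioIstarZero_closed` (TYPE VERBATIM), := `(….mpr ⟨stub 1a, (stub 1b)₁, (stub 1b)₂⟩)` with hmod = `stub_printFactsKato.2.1` and hGZK =
`stub_printInputsInert.2`.  NEW PRINT-BY-PROOF stub 1a `stub_hasPRRatioIstarZero` = (E): on every row `∃ ℒ : ℚ_[p], Kato2004.PRRatio W p ℒ` — the
value-pinned Kato zeta descent datum with its Perrin-Riou ratio is REALISABLE (module docstring of `Kato2004/PerrinRiouRatio.lean` «JUNK AUDIT …
REALISABLE by PRINT»: Kato Thm. 12.5 (1) + §13.9 + (14.9.3) at rank one; the reading `TorsionFree.HasPRRatio Kato2004.PRRatio` of the descent files;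
the typer's target, size M–L).  NEW RESEARCH stub 1b `stub_perrinRiouLawIstarZero` = (NV) ∧ (VAL) POINTWISE: on every row, EVERY Perrin-Riou ratio
`ℒ` with `Kato2004.PRRatio W p ℒ` is non-zero and `∃ q : ℚ, L′(W,1)/(Ω_W·Reg W) = q ∧ v(ℒ) = v_p(q)` — Burns–Kurihara–Sano Conj. 2.8 (i)+(ii) up to a
`p`-adic unit for THE ratio (well-posed about every ratio by PR-INV); this is the research content of PR^× at a potentially supersingular ADDITIVE
prime, open in print (frontier: BSTW24 Thm. 6.4 `p ∤ 2N`; BKO24 App. B Thm. B.3 good non-ordinary; LTYZ25 Thm. 1.1 split bad primes; BKO24 Prop.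
4.14/Rem. 4.15 the non-vanishing half for anticyclotomic CM twists at additive `p`).  WHY ONE stub for (NV) ∧ (VAL): both are statements about
the same number `ℒ`, (VAL) presupposes (NV) (`v(0)` is junk), and the registered set stays at SEVEN (harness ceiling); the two conjuncts of
p829671's right-hand side are its projections.  STRENGTH BOOKKEEPING: granted modularity + GZK (both already stubs of the line), (1a ∧ 1b) ⟺
stub 1 (p829671, both directions) — no strength added or hidden.  Stubs 2c-T1, 2c-T2, 5, 6a, 6b, `muColPlusAdmissibleIstarZero_closed`,
`katoMuEqualityIstarZero_closed`, `lengthEq_closed`, `kmcFine_closed`, `rowCount_closed`, `realizable_closed` are BYTE-IDENTICAL to v12; the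
composition head reads `perrinRiouRatioIstarZero_closed` where v12 read stub 1 (one token).  Registered stubs after this file:
`stub_hasPRRatioIstarZero` (PRINT-BY-PROOF, new), `stub_perrinRiouLawIstarZero` (RESEARCH, new), `stub_zetaLinesProportionalIstarZero`
(PRINT-BY-PROOF), `stub_twistExponentEqIstarZero` (RESEARCH), `stub_printFactsKato` (PURE-CITE, eight), `stub_plusMCEtaK` (ROUTE CRUX 19501),
`stub_printInputsInert` (PURE-CITE).  VACUITY (D440) for 1a / 1b: 1a is an `∃` over the PRINT-EXACT predicate `Kato2004.PRRatio` (realisable,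
not junk: its JUNK AUDIT); 1b's hypothesis `PRRatio W p ℒ` is inhabited exactly when 1a holds, its conclusion `ℒ ≠ 0 ∧ v(ℒ) = v_p(q)` is neither
⊤ nor definitional (the disprover's target on one row: `v(ℒ) − v_p(L′(W,1)/(Ω_W·Reg W))`, predicted `0`).

WHAT CHANGED vs v11 (v12 = the PRINT ∣ RESEARCH SPLIT of stub 2c asked by refill hand `leafhand-bsd-inertbadsignedbran-6` g0, REPORT-AND-STOP
2026-08-31T17:09Z, bsd-cm INBOX l.494; census `pub/bsd-eis/leafhand-bsd-inertbadsignedbran-6-g0/CENSUS-19223-leafhand-6-g0.md` 80677eb0d12bd4d1; its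
def-free helper landing `--supports 19223` p828865 + append p829274 `Theorems/InertBadSignedBranchesCccOneLawOnTypeIstarZeroAdmissiblePackage.lean`:
§2 `CccOneAdmissiblePackage.stub2c_of_admissiblePackage` (stub 2c's registered signature VERBATIM ⟸ 19867 + ★ + GZK + (ADM)), §3
`CccOneAdmissiblePackage.stub2c_iff_exponent_eq` (granted 19867 + ★ + `rank_{ℤ_p} H¹(ℤ[1/p], T_pW) ≤ 1` and ONE `ℚ_pˣ`-proportionality
`(p : Λ)^a • P₁.z = (p : Λ)^b • z₁` with `z₁` admissible: the stub-2c equality at EVERY `(P, z₀)` on the pin ⟺ `a = b`) and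
`CccOneAdmissiblePackage.stub2c_of_proportional_of_eq`; building on hand -5's package rigidity p827306/p827380/p827793/p827773 and hand -4's
collinearity μ-dictionary p825019–p825574).  v11's RESEARCH stub 2c `stub_muColPlusAdmissibleIstarZero` («μ(Col⁺(loc z₀)) = μ(L_p⁺(V, η, X))»
for every package `P` and every admissible `z₀` on every pin of every row) LEAVES the registered set: its statement is now the sorry-free
`muColPlusAdmissibleIstarZero_closed` (TYPE = v11's stub 2c VERBATIM), proved from (i) the NEW PRINT-BY-PROOF stub 2c-T1
`stub_zetaLinesProportionalIstarZero` — on every pin `I` of every row, in every `η`-frame of the Kobayashi package fact (frame binders = stub 2c's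
VERBATIM through `∀ (I : IwasawaH1Data W p κ γ)`): SOME Kobayashi package `P₁` (on some dual fine Selmer datum `FB₁`), SOME admissible Kato class
`z₁` and exponents `a b : ℕ` with `(p : Λ)^a • P₁.z = (p : Λ)^b • z₁` — «Kobayashi's `ε_η z_{η(−1)}` of the good twin `V`, read in `𝐇¹_Γ(T_pW)`
through `C • W^{(p*)} = V`, and Kato's `Ω_W`-normalised class `𝐳_{γ_W}` of `W = V ⊗ η` are `ℚ_pˣ·Λˣ`-PROPORTIONAL» (print, no period
COMPUTATION: both classes have `exp*`-values `c_i(χ)·L(W, χ̄, 1)` at every character `χ` of `Γ` — Kato Thm. 12.5 (1) for `f_V` at `ηχ`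
(Kobayashi Thm. 6.3) and for `f_W = f_V ⊗ η` at `χ`, `L(V, ηχ, s) = L(W, χ, s)` — hence are `Frac(Λ)`-proportional by Thm. 12.4 (2) +
Rohrlich (= ★ on the rank-`≤ 1` branch), and the ratio `χ ↦ c_2(χ)/c_1(χ)` is a CONSTANT of `ℚ̄ˣ` (same Gauss sum and Euler factors on both
sides), whose prime-to-`p` part is absorbed into `z₁` by `IsAdmissibleZetaClass.units_smul`; the package and the admissible class EXIST on the pin
by the package fact `.2.2.2.2.2.2.1` and F-CM `.2.2.1`); (ii) the NEW, SHARPER RESEARCH stub 2c-T2 `stub_twistExponentEqIstarZero` — for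
every such proportionality on the pin, `a = b`: ONE INTEGER IDENTITY PER PIN (hand -4's `e = 0`, hand -5's DERIVATION-ZC, hand -6's scaling
invariance of Kato's normalisation along `φ : V ≅ W` over `ℚ(√p*)`: the `p`-adic valuation of the twist-period / differential constant of
`W = V ⊗ η` is `0`; the difference `a − b` is pin-determined by torsion-freeness, package rigidity p827306 and ★); (iii) PRINT: `stub_printFactsKato`
grows from SEVEN to EIGHT conjuncts — + ★ `Kato2004.exists_zetaClassPosition_of_rank_le_one` (Literature `Kato2004/ZetaClassOnRankLeOneBranch.lean`:
Kato Thm. 12.5 (1)(2) / §13.9 / Lemma 13.10 (1) on the rank-`≤ 1` branch; already typed in the tree: named-fact debt of the TREE unchanged,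
named-fact LEDGER of the line 7 → 8; appended LAST, so conjuncts 1–6 keep their paths, the Kobayashi package fact moves `.2.2.2.2.2.2` →
`.2.2.2.2.2.2.1` and ★ is `.2.2.2.2.2.2.2`); GZK is read from the PURE-CITE stub 6b `stub_printInputsInert.2`, which is MOVED above its new in-file
consumer (text unchanged).  The composition `muColPlusAdmissibleIstarZero_closed`: GZK on the row (`r_an = 1` ⇒ Mordell–Weil rank one and `Ш(W)`
finite ⇒ `rank_{ℤ_p} H¹(ℤ[1/p], T_pW) ≤ 1` by `LocPKummer.rank_integralH1_le_one`); the proportional pair of stub 2c-T1; `a = b` by stub 2c-T2;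
then `CccOneAdmissiblePackage.stub2c_of_proportional_of_eq` (granted 19867 = `.2.2.2.2.2.1` and ★ = `.2.2.2.2.2.2.2`).  WHY THE SPLIT IS NOT
COSTUME AND WHAT IT ADDS: granted ★ + 19867 + GZK, (2c-T1 ∧ 2c-T2) ⟹ 2c (this file) and 2c ⟹ 2c-T2 (`stub2c_iff_exponent_eq`, `→`), so
(2c-T1 ∧ 2c-T2) ⟺ (2c-T1 ∧ 2c); the registered set is STRONGER than v11's by exactly the print-by-proof statement 2c-T1 (declared, labelled,
the typer's target) and its RESEARCH content is WEAKER and sharper: one integer identity per pin instead of an equality of two `μ`-invariants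
for all packages and classes.  This supersedes D1169 (b)/(c) (hVL′ as the typer row): hVL′ («value law of `Col⁺` on EVERY admissible class»)
is stronger than 2c and of doubtful typability (Kobayashi states the value law for Kato's element only — hand -6 concurs); 2c-T1 is weaker than
hVL′ and typeable now (size S–M).  Stubs 1, 5's first seven conjuncts, 6a, 6b (moved), `katoMuEqualityIstarZero_closed` (now reading
`muColPlusAdmissibleIstarZero_closed` and the package fact at `.2.2.2.2.2.2.1`), `lengthEq_closed`, `kmcFine_closed`, `rowCount_closed`,
`realizable_closed` and the composition head are otherwise BYTE-IDENTICAL to v11.  Registered stubs after this file: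
`stub_perrinRiouRatioIstarZero` (RESEARCH), `stub_zetaLinesProportionalIstarZero` (PRINT-BY-PROOF, new), `stub_twistExponentEqIstarZero`
(RESEARCH, new), `stub_printFactsKato` (PURE-CITE, eight), `stub_plusMCEtaK` (ROUTE CRUX 19501), `stub_printInputsInert` (PURE-CITE).
VACUITY (D440) for 2c-T1 / 2c-T2: binders = the Kobayashi fact's frame (jointly satisfiable on every row: the fact inhabits a package on every
`(I, FB)`, F-CM gives an admissible class since `W = V ⊗ η` is CM, `p ≥ 5` is inert in the CM field and `W[p]` is irreducible); 2c-T1's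
conclusion is an `∃` of a Λ-module identity between two NON-ZERO elements (`CccOneCollinearMu.ne_zero_of_isAdmissibleZetaClass`, `P₁.z ≠ 0`
inside `stub2c_iff_exponent_eq`), not junk-true, not ⊤; 2c-T2's hypotheses are inhabited exactly when 2c-T1 holds and its conclusion `a = b` is
one decidable integer identity whose two sides are NOT definitionally related (torsion-freeness fixes `a − b` per pin; the stub asserts it is
`0`) — the disprover's target: the integer `a − b` on ONE row (predicted `0`).

WHAT CHANGED vs v10 (v11 = the RESHAPE asked by refill hand `leafhand-bsd-inertbadsignedbran-4` g0, REPORT-AND-STOP 2026-08-31T14:25Z,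
bsd-cm INBOX l.480; census `pub/bsd-eis/leafhand-bsd-inertbadsignedbran-4-g0/CENSUS-19223-leafhand-4-g0.md` 5dd651acccdde71c; its four
def-free helper landings `--supports 19223`: p825019 `Theorems/…CollinearMu.lean` (collinearity μ-dictionary), p825122 `…CollinearMuAdmissible.lean`
(stub 2b's binders from tree theorems; Coleman-image form `CccOneCollinearMu.zcMu_iff_lengthAt_colPlus`), p825445 `…CollinearMuPrediction.lean`
(«ZC-μ ⟺ μ(Col⁺(loc z₀)) = μ(L_p⁺(V, η, X))»), p825574 `…CollinearMuRows.lean` (on the rows, frame supplied); and hand -3's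
`…MuDictionaryEtaKeying.lean` §1–§3 (every keying `(K, γ)` is a unit twist of the frame's `κ`; `length_(p)` and admissibility are
`changeData`-invariant: `CccOneMuDictionaryEta.lengthAt_quotient_span_changeData_eq_of_asIdeal_eq_augIdealP`,
`Kato2004.IsAdmissibleZetaClass.changeData`; stub 2b's sentence HOLDS at Kobayashi's `η`-class:
`CccOneMuDictionaryEta.lengthAt_contra_fine_eq_lengthAt_quotient_unitTwist_of_plusMCEtaKMuPart`)).  v10's RESEARCH stub 2b
`stub_katoMuEqualityIstarZero` (the μ-EQUALITY AT `(p)`: `length_(p) Y.X = length_(p) (𝐇¹_Γ ⧸ Λz₀)` for every admissible `z₀`, every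
keying) LEAVES the registered set: its statement is now the sorry-free `katoMuEqualityIstarZero_closed` (TYPE = v10's stub 2b VERBATIM),
proved from (i) the NEW, SHARPER research stub 2c `stub_muColPlusAdmissibleIstarZero` — for a Kobayashi package `P` (the hypothesis
structure `Kobayashi2003.EtaColemanPoitouTateData` of the named fact `Kobayashi2003.thm62_63_73_etaColemanPoitouTate`, binders = that
fact's `η`-frame VERBATIM + `V.HasCM` + the row binders) and an ADMISSIBLE Kato class `z₀` on the same pin:
`length_(p) (Λ ⧸ (P.colPlus z₀)) = length_(p) (Λ ⧸ (P.colPlus P.z))`, i.e. «μ(Col⁺(loc z₀)) = μ(L_p⁺(V, η, X))» (`P.colPlus P.z` is a plus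
function by `P.isPlus_colPlus_z`) — the hand's STUCK GOAL verbatim, now a registered signature (the disprover's target: the integer
`μ(Col⁺ z₀) − μ(L_p⁺(V, η))` on one row); (ii) ROUTE-CRUX stub 6a `stub_plusMCEtaK` (19501 ⟹ its μ-part 19865 pointwise by the kernel
μ-criterion `PlusMCEtaKUpToMu.plusMCEtaK_iff_muInvariant_eq_of_burungaleTian`, granted 19867); (iii) PRINT: `stub_printFactsKato` grows from
FOUR to SEVEN conjuncts — + Mazur's `p ∤ c₀` `ModularForms.mazur_not_dvd_maninConstant_of_odd` (for the period ratio `ϖ` of the twin,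
`Additive.periodRatio_of_mazur`), + the route's named-fact item 19867 `PublishedInputsEtaUpToP` BY NAME, + the Kobayashi package fact
`Kobayashi2003.thm62_63_73_etaColemanPoitouTate` (Kobayashi 2003 Thm. 6.2/6.3/7.3 i)/Cor. 7.2 at η, Literature; all three already typed in
the tree: named-fact debt of the TREE unchanged, named-fact LEDGER of the line 4 → 7; BT26 moves to `.2.2.2.1`, so `lengthEq_closed` reads
`stub_printFactsKato.2.2.2.1 katoMuEqualityIstarZero_closed`).  The composition `katoMuEqualityIstarZero_closed`: build the η-frame of the
row exactly as `CccOneMuDictionaryEta.exists_kobayashiClass_lengthAt_fine_eq_onType_IstarZero_of_plusMCEtaKMuPart` does (CM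
good-supersingular twin `X12.O10.exists_goodTwist_pStar_of_hasSignedLocalType_IstarZero`, modularity `.2.1`, Mazur, `K₀ = ℚ(μ_p)` with the
quadratic `η`, a cyclotomic `(κ, γ)` on the cyclotomic variable), write stub 2b's `K` as `κ.unitTwist c`, take the package `P` on the
re-keyed pin `I.changeData κ c _ _`, get stub 2b's sentence AT `P.z`, and replace `P.z` by `z₀` through stub 2c read by
`zcMu_iff_lengthAt_colPlus` and the two `changeData` invariances.  WHY THE RESHAPE IS NOT COSTUME: given (ii)+(iii), stub 2c ⟺ stub 2b on the
rows (hand -3's §4 `lengthAt_quotient_admissible_eq_kobayashiClass_of_stub2b` is the converse), so no strength is hidden or added; what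
changes is the CURRENCY — two power series in `Λ` (`Col⁺(loc z₀)` against `L_p⁺(V, η, X)`) instead of two module lengths — which is where
the remaining print inputs live (Kato Thm. 12.5 (1) values of `exp*` on the admissible class; Kobayashi (6.13)/Thm. 6.3 interpolation of
`Col⁺`; the twist-period constant of `W = V ⊗ η`, a `p`-adic unit for `p ≥ 5` — the hand's «What is missing» 1–2, sizes M and S–M).
Stubs 1, 5's first four conjuncts, 6a, 6b, `kmcFine_closed`, `rowCount_closed`, `realizable_closed` and the composition head are
BYTE-IDENTICAL to v10.  Registered stubs after this file: `stub_perrinRiouRatioIstarZero` (RESEARCH), `stub_muColPlusAdmissibleIstarZero`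
(RESEARCH, new), `stub_printFactsKato` (PURE-CITE, seven), `stub_plusMCEtaK` (ROUTE CRUX 19501), `stub_printInputsInert` (PURE-CITE).
VACUITY (D440) for stub 2c: binders = the Kobayashi fact's frame (jointly satisfiable on every row: the fact itself inhabits `P` there, F-CM
gives an admissible `z₀`), conclusion an equality of two `ℕ∞`-valued lengths of cyclic torsion modules — finite on both sides
(`P.colPlus` injective, `z₀ ≠ 0`), not junk-true, not ⊤; junk packages are excluded by quantifying only over the fact's frame
(`C • W.quadraticTwist p* = V`, `IsNewformOf V f`, the period relation of `ϖ`, `γ ∈ Gal(ℚ̄/ℚ(μ_p))` on the cyclotomic variable).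

WHAT CHANGED vs v9 ((T22) CORRECTION, seat prr-ty1 g21, STATUS l.3146; ruling D761 = (a)).  v4–v9's «PURE-CITE» stub 6
`stub_printInputsInert : PrintReadingsInert ∧ PublishedFactsInert` was MISLABELLED: `PrintReadingsInert` is route item 19226, which rev-13 of
the route carries as an ASIDE out of the cone of `closes` (planner D92: retired in favour of the crux `PlusMCEtaK` 19501 + the named-fact
item `SignedReadingFacts`), and its first conjunct (C1_η) `Additive.QuadraticBranchPlusMainConjectureAt` (the ℚ(√p*)-form plus main
conjecture; Pollack–Rubin 2004 p. 448 remark only) is CONJECTURE-GRADE and staffed by nobody — and the v4–v9 head consumed it GENUINELY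
(E50 §2 / E55 §1 → `CccOneLowerHalf.cccOneLawOnTypeIstarZero_of_bsdpOnType h₅ …`, feeding (C1_η) into the `h1` slot of
`quadraticBranchPAdicGrossZagierValuationAt_of_bsdp_of_readings`).  E58 p739176
`Rank1Residual/Additive/KatoDescentKMCImpReadingIstarKForm.lean` 7b88763012f6746f (g21; theorems only; commit 7254bfdad961) re-keys the
GZK-guarded ROW-REALISED head to the ROUTE OF RECORD: ★★★ §2
`KMCImpReadingPointwise.cccOneLawOnTypeIstarZero_of_rowCountOfGZK_of_rowRealizableOfGZK_of_kmcFineContra_of_perrinRiouRatio_of_plusMCEtaK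
(hCrows) (hrealRows) (hKMC) (hPR) (hK : PlusMCEtaK) (hR : SignedReadingFacts) (hnf : exists_isNewformOf) (hGZK) (hPT)` (per pair: Part 50 §1
`rankOne_bsdp_of_countAt`, then k8i-c2 g4's (K)-form converse `CccOneKFormConverse.cccOneLawOnTypeIstarZero_of_bsdpOnType_of_plusMCEtaK`,
`Theorems/…CccOneLawOnTypeIstarZeroOfBSDpKForm.lean` §3; entire `L` from modularity by `hasEntireLFunction_rat_of_exists_isNewformOf`).
Hence v10: stub 6 is SPLIT into `stub_plusMCEtaK : PlusMCEtaK` [ROUTE CRUX 19501 — by-name split on the ledger: up-to-μ child 19866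
CLOSED from Burungale–Tian Thm. 2.6 at η + Kobayashi Thm. 2.2 (inputs 19867), μ-part child 19865 RESEARCH/RESIDUAL (conjecture-grade, open in
print); a SEPARATE stub so that 19223's dependence on 19501 is explicit; the rung leaf bridge 19503 consumes 19501 next to 19223 anyway]
and `stub_printInputsInert : SignedReadingFacts ∧ rank_eq_analyticRank_of_analyticRank_le_one` [PURE-CITE: the route's named-fact item 19502
(Kitajima–Otsuki 1.3, Kobayashi 7.4) + GZK rank part]; Poitou–Tate over ℚ is a THEOREM of the tree
(`SchneiderFreeAdditiveX3.PoitouTateReduction.poitouTate_selmerStructure_duality_real_holds ℚ`, cell bsd-schneider p626891; K8 item 19417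
CLOSED p628462) and is DISCHARGED inside E59 p739642 `…KatoDescentKMCImpReadingIstarKFormReal.lean` f9414d434b6baeea (g21 (T23): E58 §2 at
`hPT := …_holds ℚ`, head `…_of_plusMCEtaK_real`); the composition points to E59.
Stubs 1, 2b, 5, `lengthEq_closed`, `kmcFine_closed`, `rowCount_closed`, `realizable_closed` BYTE-IDENTICAL to v9.  Registered stubs after
this file: `stub_perrinRiouRatioIstarZero` (RESEARCH), `stub_katoMuEqualityIstarZero` (RESEARCH), `stub_printFactsKato` (PURE-CITE, four named
facts), `stub_plusMCEtaK` (ROUTE CRUX 19501), `stub_printInputsInert` (PURE-CITE).  READING OF RECORD (v10): crux 19223 ⟸ RESEARCH {PR^× over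
`Kato2004.PRRatio`; μ-EQUALITY at (p)} on the rows ∪ ROUTE CRUX {`PlusMCEtaK` 19501, open part = its μ-part 19865} ∪ PRINT {H2X′,
modularity-with-level, F-CM, BT26 Thm. 2.6, Kitajima–Otsuki 1.3, Kobayashi 7.4, GZK} (Poitou–Tate DISCHARGED); (C1_η), (R2)-as-conjecture,
GZ I.(7.3), Mazur–Manin and the separate entire-`L` fact are OUT of this cone.  E57 p738881 / E58 p739176 heads are not used directly.
VACUITY (D440): `stub_plusMCEtaK` is the route's own crux verbatim (a `def … : Prop`, not restated); the new cite conjuncts are named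
facts / the route's fact item BY NAME.

WHAT CHANGED vs v8 (v9, kept as history; stub 2a LEAVES the registered set — its content is PRINT).  Seat prr-ty1 g20 typed Burungale–Tian 2026 Thm. 2.6 as the
named fact `Kato2004.BurungaleTian2026_lengthEq_offMu_of_hasCM` (Literature p736588 `Kato2004/KatoMainConjectureCMOffMu.lean` 01ab23195e38f83b,
REVIEW LANE PASSED; F-CM binder shape, `p ≠ 2`, `W.HasCM`; docstring = Thm. 2.6 / Rem. 2.7 verbatim + the EFFECTIVE READING (R1)–(R4), (R3)
«Z(f) ⊗ ℚ on the Δ-trivial component = Λz₀ ⊗ ℚ for admissible z₀» tagged CELL-AUDIT; named-fact debt +1, planner D748) and the row lemmas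
p737094 `Rank1Residual/Additive/KatoDescentLengthEqualityOffMuIstarZero.lean` a69503d5dbae0f40 (`StrictCount.katoLengthEqualityOffMu_istarZero_of_fact` :
fact BY VALUE → v8 stub 2a VERBATIM, `W.HasCM = hT.1`, `p ≠ 2` from `5 ≤ p`; `…katoLengthEquality_istarZero_of_fact_of_atMu` : fact → AT-μ → v7 stub 2
VERBATIM).  Hence `stub_printFactsKato : H2X′ ∧ modularity ∧ F-CM ∧ BT26` (FOUR conjuncts) and `lengthEq_closed :=
…_of_fact_of_atMu stub_printFactsKato.2.2.2 stub_katoMuEqualityIstarZero` (the named `def … : Prop` unfolds to the by-value binder by δ);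
`kmcFine_closed` reads F-CM at `.2.2.1` (was `.2.2`); `stub_katoLengthEqualityOffMuIstarZero` is DELETED (its text survives as the conclusion of
p737094's first theorem).  Stubs 1, 2b, 6, `rowCount_closed`, `realizable_closed` and the composition head are BYTE-IDENTICAL to v8.  Registered
stubs after this file: `stub_perrinRiouRatioIstarZero` (RESEARCH), `stub_katoMuEqualityIstarZero` (RESEARCH), `stub_printFactsKato` (PURE-CITE, four
named facts), `stub_printInputsInert` (PURE-CITE = route items).  READING OF RECORD (v9): crux ⟸ RESEARCH {PR^× over `Kato2004.PRRatio`;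
μ-EQUALITY at (p) = Burungale–Tian Rem. 2.7} on the rows ∪ PRINT {H2X′, modularity-with-level, F-CM (Kato 15.21), BT26 Thm. 2.6 (Kato 12.10 off μ)}
∪ the route's inert print items; GZK as in v5.  Named-fact debt of the line: +2 (F-CM, BT26).  VACUITY (D440): the new cite conjunct is a
cite-tagged named fact whose binders are jointly satisfiable (CM W, p odd, admissible z₀ exists by F-CM on the rows) and whose conclusion is an
equality of lengths — not junk-true; the rest as v8.

WHAT CHANGED vs v7 (v8, kept as history; the (T20) split — a DECOMPOSITION of research stub 2 along the seam found by seat prr-ty1 g20's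
LENGTH-EQUALITY AUDIT `bsd-cm-prr-ty1/g20/LENGTH-EQUALITY-AUDIT.md` c8589c4385314bf5, reading of record D743).  v7's
`stub_katoLengthEqualityIstarZero` (Kato Conj. 12.10 LENGTH EQUALITY at EVERY height-one prime `𝔮` of `Λ = ℤ_p⟦T⟧` on the rows)
is MIXED and is SPLIT at the one prime `(p)` (`IwasawaAlgebra.augIdealP p`; for height-one `𝔮`, `p ∈ 𝔮 ↔ 𝔮 = (p)`,
p735452 `StrictCount.natCast_mem_asIdeal_iff_eq_augIdealP`): OFF μ — `stub_katoLengthEqualityOffMuIstarZero` (the same clause with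
the extra binder `𝔮.asIdeal ≠ IwasawaAlgebra.augIdealP p`; label PRINT-MODULO-DICTIONARY: Kato's Conj. 12.10 in Λ ⊗ ℚ for every CM newform
and EVERY prime p is Burungale–Tian, Ann. of Math. 203 (2026), THEOREM 2.6 (proof = Kato §15 fed with Johnson-Leung–Kings 2011 Thm. 5.2
in place of Rubin; = seat prr-ty1 g19's road, printed), and «in Λ ⊗ ℚ» = «at every height-one 𝔮 ∌ p»; the dictionary to this clause
(Δ-trivial component; 𝐇²_Γ vs X₀^{γ⁻¹} lengths via H2X′; Z(f) ⊗ ℚ = Λz₀ ⊗ ℚ for admissible z₀) is cite/audit level — the stub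
becomes a cite conjunct + row lemma when the named fact lands (seat prr-ty1 g20, (T20-F)); «blocked-on: Rubin IMC» is retired as a
label) and AT μ — `stub_katoMuEqualityIstarZero` (extra binder `𝔮.asIdeal = IwasawaAlgebra.augIdealP p`; label RESEARCH = Burungale–Tian's
own Remark 2.7 «a finer analysis of [Kato, §15] is essential to relate the integral versions»: residue (r3) the λ-adic unit comparison of
the elliptic-unit and Ω_W-normalised Kato zeta lines at (p), Kato Lemma 15.22 «almost all λ», ineffective; (r1) retired, audit memo v3).
They recompose IN-FILE (`lengthEq_closed`, type = v7 stub 2 VERBATIM, by the 3-line `by_cases` on `𝔮.asIdeal = augIdealP p` — the proof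
of p735452 `StrictCount.katoLengthEquality_istarZero_of_offMu_of_atMu` inlined, so this file does not import that module; the split is an
equivalence, `…_offMu_of_full` / `…_atMu_of_full` there), and `kmcFine_closed` reads `lengthEq_closed` where v7 read the
stub.  Stubs 1, 5, 6, `rowCount_closed`, `realizable_closed` and the composition head are BYTE-IDENTICAL to v7.  Registered stubs after
this file: `stub_perrinRiouRatioIstarZero` (RESEARCH), `stub_katoLengthEqualityOffMuIstarZero` (PRINT-MODULO-DICTIONARY), `stub_katoMuEqualityIstarZero`
(RESEARCH), `stub_printFactsKato` (PURE-CITE, three named facts), `stub_printInputsInert` (PURE-CITE = route items).  READING OF RECORD (v8):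
crux ⟸ CONTENT {PR^× over `Kato2004.PRRatio`; μ-EQUALITY AT (p)} ∪ PRINT-MODULO-DICTIONARY {Kato 12.10 OFF μ, Burungale–Tian Thm. 2.6} on the rows ∪ PRINT
{H2X′, modularity-with-level, F-CM} ∪ the route's inert print items; GZK as in v5.  Named-fact debt of the line: +1 (F-CM), unchanged.
VACUITY (D440) for the two new stubs: OFF μ — height-one primes `𝔮 ≠ (p)` exist (e.g. `(T)`), binders jointly satisfiable on row
bsd-cm-8-p1's pairs as for v7 stub 2, conclusion an equality of lengths, not ⊤; AT μ — exactly the prime `(p)`, height one by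
`IwasawaAlgebra.height_augIdealP_holds` (p735452 `StrictCount.height_asIdeal_augIdealP_eq_one`), so not vacuous; neither is v7 stub 2 reworded
(each is a strict restriction; only jointly do they give it back).

WHAT CHANGED vs v6 (v7, kept as history; the (T19) split).

(director-bsd RESTUB rule (ii): a stub that MIXES print facts with content is SPLIT.)
Seat prr-ty1 g19's INTEGRALITY AUDIT (Kato, Astérisque 295: Prop. 15.21 first part p. 266 + proof p. 267 l. 5–6 via §13.14,
Lemma 14.7, Lemma 15.20, Thm. 12.4 (3); §15.16) found the FIRST conjunct of `KatoMainConjectureFineContra W p` on the rows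
`(p, I₀*)`, `p ≥ 5` («an ADMISSIBLE zeta class exists», `Z(f, T_pW) ⊂ 𝐇¹(T_pW)`) to be PRINT-BY-PROOF: it is the named fact
`Kato2004.exists_isAdmissibleZetaClass_of_hasCM_of_irreducible` (Literature p731776, F051's binder shape with
`ImageContainsSL2 ↦ HasCM ∧ ¬CMRamified ∧ HasIrreducibleModPGaloisRep p`, `p ≠ 2`) applied through the ROW LEMMA
`StrictCount.hasIrreducibleModPGaloisRep_of_hasSignedLocalType_IstarZero` (p731778: type I₀*, p ≥ 5 ⇒ W[p] irreducible,
Serre 1972 Prop. 12 on the good twist V^{(p*)}).  Hence v6's RESEARCH stub 2 `stub_katoMainConjectureFineIstarZero` is SPLIT: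
its ∃-conjunct becomes the THIRD conjunct of the cite stub (`stub_printFactsKato : H2X′ ∧ modularity ∧ F-CM`), closed on
the rows IN-FILE (`kmcFine_closed` := p731778 `StrictCount.katoMainConjectureFineContra_istarZero_of_fact_of_lengths`), and
the NEW research stub `stub_katoLengthEqualityIstarZero` carries ONLY Kato's Conj. 12.10 LENGTH EQUALITY on the rows (its
statement = the (∀)-clause of the `def` body of `KatoMainConjectureFineContra` under the row binders, VERBATIM = p731778's
`hlen`).  `rowCount_closed` now reads modularity at `stub_printFactsKato.2.1` (was `.2`); stubs 1 and 6, `realizable_closed`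
and the composition head are BYTE-IDENTICAL to v6.  Registered stubs after this file: `stub_perrinRiouRatioIstarZero`
(RESEARCH), `stub_katoLengthEqualityIstarZero` (RESEARCH — the director's «blocked-on: Rubin IMC» content, D0168-BSD-ROWS-v1),
`stub_printFactsKato` (PURE-CITE, three named facts), `stub_printInputsInert` (PURE-CITE = route items).  READING OF RECORD (v7):
crux ⟸ RESEARCH {PR^× over `Kato2004.PRRatio`, Kato 12.10 LENGTH EQUALITY (fine, contragredient key)} on the rows ∪ PRINT
{H2X′, modularity-with-level, F-CM (print-by-proof)} ∪ the route's inert print items; GZK as in v5.  Named-fact debt of the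
line: +1 (F-CM, granted D724).

WHAT CHANGED vs v5 (v6, kept as history; the (T17) touch).  The cite stub `stub_printFactsKato` SHRINKS from three conjuncts to two —
`Kato2004.thm12_4` LEAVES the cone: seat prr-ty1 g17 typed Kato Thm. 12.4's rank-one content BY PROOF on the rows
(E51 `KatoDescentPerrinRiouRatioRankOne` p724787: PR-INV at rank one from modularity; E52
`KatoDescentRankOneCountReadingOfLoc` p725511: the count reading from H2X′'s localisation clause + a row predicate;
E53 `KatoDescentRankOneCountRowsOfLoc` p726433: the row heads keyed to modularity; E54 `KatoDescentRealizableContraRankOne`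
p725830: realisability of the descent datum ON THE ROWS from H2X′ alone; E55 `KatoDescentKMCImpReadingRowRealizable`
p725842: E50's composition head re-keyed to the row-keyed realisation).  Hence: `stub_printFactsKato : H2X′ ∧
ModularForms.exists_isNewformOf`; `rowCount_closed` (TYPE UNCHANGED) := E53 `StrictCount.rankOneCountReading_istarZero_of_loc_of_modularity`;
`realizable_closed` is now ROW-KEYED and GZK-guarded (type = E54 `StrictCount.realizableIstarZeroOfGZK_of_loc`'s conclusion
VERBATIM, replacing v5's generic `TorsionFree.RealizableOfKMC …`, which needed 12.4 off the rows); the composition points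
to E55's head.  Stubs 1, 2, 6 BYTE-IDENTICAL to v5 (names unchanged; the registered stub set is v5's with the
shrunken cite stub).  READING OF RECORD (v6): crux ⟸ RESEARCH {PR^× over `Kato2004.PRRatio`, Kato 12.10 fine-contra}
on the rows ∪ PRINT {H2X′, modularity-with-level} ∪ the route's inert print items `PrintReadingsInert` / `PublishedFactsInert`; GZK as in v5.

WHAT CHANGED vs v4 (v5, kept as history).  v4's PRINT stubs 3 (`stub_rankOneCountReadingKato`, the GENERIC rank-one count) and 4
(`stub_realizableOfKMCFine`) were MIXED (print content + display): their print content is typed BY NAME in the tree —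
E48 `StrictCount.rankOneCountReading_istarZero_of_facts` (p719298: stub 3 ON THE ROWS of the type `(p, I₀*)`, `p ≥ 5`,
rank one ⟸ {GZK, Carayol's level, Kato Thm. 12.4, H2X′}; side inputs `noPTorsion_padic_of_hasSignedLocalType_IstarZero`,
`not_dvd_torsionOrder_of_hasSignedLocalType_IstarZero`), E49 `…_of_named_facts` / `…_of_modularity` /
`StrictCount.realizableOfKMC_contra_of_thm12_4_of_loc` (p721157), the Literature fact H2X′ (p719171), and E50's POINTWISE
descent + GZK-guarded ROW-KEYED head `KMCImpReadingPointwise.cccOneLawOnTypeIstarZero_of_rowCountOfGZK_of_kmcFineContra_of_perrinRiouRatio`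
(p721932; GZK = `PublishedFactsInert.2.2.1`).  v5 DROPS stubs 3/4, ADDS the pure-cite stub
`stub_printFactsKato : Kato2004.thm12_4 ∧ H2X′ ∧ ModularForms.exists_isNewformOf`, closes the row count (`rowCount_closed`,
GZK-guarded) and v4's stub 4 VERBATIM (`realizable_closed`) IN-FILE, and re-points the composition to E50's head.
Stubs 1, 2 and 6 are v4's BYTE-IDENTICAL (names unchanged); registered stubs after this file: `stub_perrinRiouRatioIstarZero`
(RESEARCH, row bsd-cm-8-p1), `stub_katoMainConjectureFineIstarZero` (RESEARCH), `stub_printFactsKato` (PURE-CITE),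
`stub_printInputsInert` (PURE-CITE = route items `PrintReadingsInert` ∧ `PublishedFactsInert`).
READING OF RECORD (v5, superseded above): crux 19223 ⟸ RESEARCH {PR^× over `Kato2004.PRRatio` on the type, Kato 12.10 fine-contra on the type} ∪
PRINT {Kato Thm. 12.4, H2X′, modularity-with-level} ∪ the route's two support items.

THE LINE (unchanged from v4 in substance).  C-cc-1 on the signed type `(p, I₀*)`, `p ≥ 5`, rank one ⟸ PR^× + KMC (fine,
contragredient print-exact key of p628155) at every pair of the type, by the Burns–Kurihara–Sano descent at r = 1 in Kato's
`𝐇²`-formalism (`BSDp` at the pair) and `cccOneLawOnTypeIstarZero_of_bsdpOnType`.  CONVENTION Q, the UNIT GUARD note and the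
v2 → v3 → v4 history are as in v4's docstring (git history of this file); `p ≥ 5` throughout, so the designed falsity of
`KatoMainConjectureFineContra` at p = 2 and Kato's exceptional (W, 3) are moot.
DEGENERATE-WITNESS / VACUITY PASS (planner D440 standard): as in the zp v5 twin — `stub_printFactsKato` = three cite-tagged (v7)
named facts (named-fact debt of record, none junk-true; F-CM: z₀ pinned up to Λˣ by the closed predicate, realisable by print at the stated
(W, p)); `stub_katoLengthEqualityIstarZero`: binders = the row binders + the `def`-body binders of `KatoMainConjectureFineContra`, jointly
satisfiable on row bsd-cm-8-p1's pairs (admissible z₀ exists there by F-CM + the row lemma), conclusion an equality of lengths — not vacuous,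
not ⊤; `kmcFine_closed` sorry-free with v6's stub-2 type VERBATIM; `rowCount_closed` / `realizable_closed` sorry-free with E50's binder
types VERBATIM; stubs 1/2 unchanged (v4 pass).
HONEST LABEL: stubs are `sorry`; nothing is asserted; the crux is concluded BY NAME; 19223 stays OPEN; X12.CMInertBad is NOT
proved; BSD is not proved for any curve.
-/

open scoped Classical NumberField

open WeierstrassCurve Literature.NumberTheory.EllipticCurves
open Literature.NumberTheory.EllipticCurves.Rank1Residual
open Literature.NumberTheory.EllipticCurves.Rank1Residual.Typed
open Literature.NumberTheory.EllipticCurves.IwasawaAlgebra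
open Summit.BirchSwinnertonDyer.Rank1Residual
open Summit.BirchSwinnertonDyer.Rank1Residual.Additive
open Summit.BirchSwinnertonDyer.Rank1Residual.X12.O10
open Literature.NumberTheory.EllipticCurves.Kato2004
open Summit.BirchSwinnertonDyer.BirchSwinnertonDyer.Theses.InertBadSignedBranches
open Summit.BirchSwinnertonDyer.BirchSwinnertonDyer.Theorems

namespace Summit.BirchSwinnertonDyer.BirchSwinnertonDyer.Cruxes.CccOneLawOnTypeIstarZero.KatoPerrinRiouIstar

/-- RESEARCH stub 1b′ (v15; the (VAL) conjunct of v13/v14's research stub 1b, whose (NV) conjunct is now print-by-proof in-file) — THE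
PERRIN-RIOU VALUATION IDENTITY OF EVERY RATIO: at every rank-one pair of the type `(p, I₀*)`, `p ≥ 5`, EVERY `ℒ` with `Kato2004.PRRatio W p ℒ` has
the Burns–Kurihara–Sano valuation `∃ q : ℚ, L′(W,1)/(Ω_W·Reg W) = q ∧ v(ℒ) = v_p(q)` — Conj. 2.8 (ii) up to a `p`-adic unit for Kato's ratio
(well-posed about EVERY ratio: any two differ by a norm-one factor, PR-INV `PerrinRiouUnit.prInv_of_modularity_of_rankOne`).  Label RESEARCH:
Perrin-Riou's conjecture at a potentially supersingular ADDITIVE prime is open in print (frontier: Burungale–Skinner–Tian–Wan 2024 Thm. 6.4 for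
`p ∤ 2N`; Burungale–Kobayashi–Ota 2024 App. B Thm. B.3 good non-ordinary — covers the good twin `V`, not `W`).  Why it might fail: (VAL) could be
off by the `p`-part of a local Tamagawa-type index at the additive prime that the unit-normalisation does not see (the (NV) half, a `p`-adic
Gross–Zagier-type non-degeneracy, is NO LONGER part of the stub: it follows on this line from Kato's Conj. 12.10 on the rows = `kmcFine_closed`,
by `CccOneHasPRRatio.perrinRiouNonvanishingIstarZero_of_kmcFineContra`, p831315).
[cite: BurnsKuriharaSano2019, Conj. 2.8 (ii) (p. 10), Thm. 1.4 (p. 4)] [cite: PerrinRiou1993AIF, §3.3]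
[cite: BurungaleSkinnerTianWan2024, Thm. 6.4] [cite: Kato2004Asterisque, Thm. 12.4 (2) and Thm. 12.5 (1) (p. 221), §13.9 (p. 230)] -/
theorem stub_perrinRiouValuationIstarZero :
    ∀ (p : ℕ) [Fact p.Prime], 5 ≤ p → ∀ (W : WeierstrassCurve ℚ) [W.IsElliptic] [W.IsGloballyMinimal],
      HasSignedLocalType W p (.Istar 0) → W.analyticRank = 1 →
      ∀ ℒ : ℚ_[p], Kato2004.PRRatio W p ℒ →
        ∃ q : ℚ, W.leadingLCoeff / ((W.realPeriodRat : ℂ) * (W.regulator : ℂ)) = (q : ℂ) ∧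
          ℒ.valuation = padicValRat p q := by
  sorry

set_option backward.isDefEq.respectTransparency false in
open Literature.NumberTheory.GaloisRepresentations Literature.NumberTheory.EllipticCurves.Kato2004.EulerSystemValues in
open scoped TensorProduct in
/-- [C]-BOOKKEEPING stub 2c-T1″ (v18; the rule-(ii) RESHAPE of v12–v17's PRINT-BY-PROOF stub 2c-T1 `stub_zetaLinesProportionalIstarZero`, which is
now the closed theorem `zetaLinesProportionalIstarZero_closed` below) — **hC″, the PER-LEVEL twist/period SCALAR comparison of the two finite-layer value
laws on the `η`-branch, in the ι-STANDARD frame**: for `V = W ⊗ η_{K₀}` (`C • W.quadraticTwist p* = V`, `V` good supersingular at `p` with `a_p = 0`),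
given a `p`-power Euler-system family `z` of `W` bound ONLY by the registered tree bodies `Kato2004.DefinedExpStarBody …` / `Kato2004.ZetaBody …` with
complex tower embeddings `ι`, a ROOT SYSTEM `ρ n ∈ ℚ(ζ_{p^{n+1}})` PINNED BY THAT SAME `ι` (`ι _ (ρ n) = exp(2πi/p^{n+1})` — no second complex family) and
`p`-adic embeddings `ιp` TAME-COHERENT on `ρ` (`Kobayashi2003.IsCoherentPadicEmbeddings p ρ ιp`, (T1)'s predicate by name), Kato's layer `exp*`-readings
`padicGaussSumAt … (ρ n) ψ′ · padicCharSum (ψ′^{pⁿ−1}) (Λ (n+1) ∅ (z (n+1)))` equal ONE constant `C′ : ℂ_p` times the value of ONE `Λ`-unit multiple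
`w · katoMultiplier …` at `ψ(γ) − 1` times Kobayashi's modular-symbol sum of `f_V` (`ratTwistedSymbolSum` / `ratMinusTwistedSymbolSum` by the parity
of `p/2`), for every even `n` and every `ψ` of order `2pⁿ`.  STATEMENT = the hypothesis `hC″` of the kernel closer
`CccOneZetaLinesCoherent.stub2cT1_of_colPlusInterpolationCoherent` (F1″, p838712) VERBATIM (text sha16 83c7d02d2ecdef61), so that closer + [A′]
(`stub_printFactsKato.2.2.2.2.2.2.2.2.1`) + [C-align] (`.2.2.2.2.2.2.2.2.2`) + F-CM (`.2.2.1`) give 2c-T1 (`zetaLinesProportionalIstarZero_closed`).  = F1's hC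
(p835994 l.187–242) by EXACTLY three hunks (pen D1216/D1218): (H1) the 5-line (COH)-on-`IsCyclotomicExtension.zeta` hypothesis DELETED (the zeta frame
was the defect of the withdrawn v16 stub `stub_twistScalarIstarZero`, critic NOTE #66); (H2) the `ρ`-block + `IsCoherentPadicEmbeddings p ρ ιp`
INSERTED around the `ιp` binder; (H3) `padicGaussSum … ψ′` ↦ `padicGaussSumAt … (ρ n) ψ′`.  PER-LEVEL, NO CROSS-LEVEL CONTENT: every compatibility
argument (trace coherence of Kato's frame [C-align], offset descent, Rohrlich at level) lives in the KERNEL GLUE W2 `Kato2004/FrameOffsetDescent.lean`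
(p838339) + F1″, where the kernel checked it.  CLASS-FREE: no `P₁`, no `Col⁺`, no `IsAdmissibleZetaClass`, no proportionality of classes.  LABEL:
BOOKKEEPING — typing debt over tree objects ((C4)/(C5) read-off of the zeta body at one level, `ι ↔ ιp` transport of character sums, the value of
`katoMultiplier` at `ψ(γ) − 1`, `η`/Birch/period bookkeeping; offset `k = 1` at every level under `ι`); NOT print debt, NOT research-grade — but unproved,
hence registered.  Hand of record: ibsb-9 (leafhand no. 51; per-level transport road p836061/p836259); an hC″-closer's conclusion must be THIS statement
verbatim.  Why it might fail: a sign / conjugation / level-change convention slip between `padicGaussSumAt`·`DirichletCharacter.changeLevel`·`Psi` on one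
side and `EulerSystemValues.charSum`/(C5) on the other makes the ratio `ψ`-DEPENDENT (not absorbable by `C′`, `w`); the residual tame freedom `ρ 0 ↦ (ρ 0)^a`
only flips every left side by the Legendre sign `ε(a)` uniformly (absorbed by `C′`, pen D1218 (2)).  Cheapest falsifier `n = 0` (`ψ` = Legendre mod `p`:
both sides vanish, `L(W,1)·(Euler-type factor) = 0` reading), then `n = 2`.  Sources: [Kato2004] Thm. 12.5/(C4)(C5); [Kobayashi2003] (3.4)–(3.6), §8.4,
Prop. 8.25–8.26; [MTT1986] §I.8 (Birch).  ELABORATION: the three prefix lines are needed under this file's `open`s (`H1`, `cycLevel`, `cyclotomicLevelsRat`,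
`GaloisRep.cyclotomicCharacter`, `⊗[ℚ]`) — statement text untouched. [cite: Kato2004Asterisque, Thm. 12.5 (1) (p. 221)] [cite: Kobayashi2003, Prop. 8.25–8.26 (pp. 24–25)] -/
theorem stub_twistScalarIstarZeroStd :
    ∀ (p : ℕ) [Fact p.Prime] (hp : p ≠ 2), 5 ≤ p →
      ∀ (K₀ : Type) [Field K₀] [NumberField K₀] [IsCyclotomicExtension {p} ℚ K₀]
        (η : Field.absoluteGaloisGroup ℚ →* ℤˣ), (∀ σ ∈ galRange (K := ℚ) K₀, η σ = 1) → η ≠ 1 →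
      ∀ (V : WeierstrassCurve ℚ) [V.IsElliptic] [V.IsGloballyMinimal] {N : ℕ} [NeZero N]
        {f : CuspForm (CongruenceSubgroup.Gamma0 N) 2},
        V.HasGoodReductionAtPrime p → V.frobeniusTrace p = 0 → ModularForms.IsNewformOf V f →
      ∀ (W : WeierstrassCurve ℚ) [W.IsElliptic] [ContinuousSMul ℤ_[p] (W.tateModule p)]
        [Module.Free ℤ_[p] (W.tateModule p)] [Module.Finite ℤ_[p] (W.tateModule p)]
        (C : VariableChange ℚ), C • W.quadraticTwist ((-1) ^ (p / 2) * p) = V →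
      ∀ (κ : ZpExtension ℚ p) (hκ : κ.IsCyclotomic)
        {NW : ℕ} [NeZero NW] (fW : CuspForm (CongruenceSubgroup.Gamma0 NW) 2), ModularForms.IsNewformOf W fW →
      ∀ (ι : (m : ℕ) → (CyclotomicField m ℚ →+* ℂ)) (q : ℚ)
        (Λ : ∀ (k : ℕ) (r : Finset (IsDedekindDomain.HeightOneSpectrum (𝓞 ℚ))),
          H1 (tateRep W p) (cycSubgroup p k r) →ₗ[ℤ_[p]]
            ℚ_[p] ⊗[ℚ] CyclotomicField (cycLevel p k r) ℚ)
        (d : _), Kato2004.DefinedExpStarBody W p fW d ι ((q : ℚ) : ℝ) Λ →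
      ∀ (c d₁ a : ℤ) (A : ℕ) (d' : ℤ), 0 < A → Int.gcd c (6 * p * A) = 1 → Int.gcd d₁ (6 * p * NW) = 1 →
        (d₁ : ℤ) * d' ≡ 1 [ZMOD (A : ℤ)] → ratCuspFactor fW true c d₁ a A d' ≠ 0 →
      ∀ (z : ∀ (k : ℕ) (r : (cyclotomicLevelsRat p (badPlaces c d₁ A NW)).Ideals),
            H1 (tateRep W p) ((cyclotomicLevelsRat p (badPlaces c d₁ A NW)).level k r.1))
        (x : ∀ (k : ℕ) (r : (cyclotomicLevelsRat p (badPlaces c d₁ A NW)).Ideals),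
            CyclotomicField (cycLevel p k r.1) ℚ),
        Kato2004.ZetaBody W p fW ι ((q : ℚ) : ℝ) Λ c d₁ a A z x →
      ∀ (qm : ℚ) (n₁ n₂ n₃ n₄ : ℤ) (σc σd : Field.absoluteGaloisGroup ℚ) (σℓ : ℕ → Field.absoluteGaloisGroup ℚ),
        0 < qm → AddSubgroup.closure (Set.range (ratMinusSymbol fW)) = AddSubgroup.zmultiples qm →
        ratMinusSymbol fW ((a : ℚ) / A) = n₁ * qm → ratMinusSymbol fW ((a * c : ℚ) / A) = n₂ * qm →
        ratMinusSymbol fW ((a * d' : ℚ) / A) = n₃ * qm → ratMinusSymbol fW ((a * c * d' : ℚ) / A) = n₄ * qm →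
        ((GaloisRep.cyclotomicCharacter ℚ p σc : ℤ_[p]ˣ) : ℤ_[p]) = c →
        ((GaloisRep.cyclotomicCharacter ℚ p σd : ℤ_[p]ˣ) : ℤ_[p]) = d₁ →
        (∀ ℓ ∈ A.primeFactors.erase p, ((GaloisRep.cyclotomicCharacter ℚ p (σℓ ℓ) : ℤ_[p]ˣ) : ℤ_[p]) = ℓ) →
      ∀ (ρ : ∀ n : ℕ, CyclotomicField (cycLevel p (n + 1) ∅) ℚ),
        (∀ n : ℕ, ι (cycLevel p (n + 1) ∅) (ρ n) = Complex.exp (2 * Real.pi * Complex.I / (p ^ (n + 1) : ℂ))) →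
      ∀ (ιp : (m : ℕ) → (CyclotomicField m ℚ →+* ℂ_[p])),
        Kobayashi2003.IsCoherentPadicEmbeddings p ρ ιp →
      ∃ (C' : ℂ_[p]) (w : (IwasawaAlgebra p)ˣ), ∀ n : ℕ, Even n →
        ∀ ψ : DirichletCharacter ℂ_[p] (p ^ (n + 1)), orderOf ψ = 2 * p ^ n →
        ∀ t : ℂ_[p],
          HasSum (fun k : ℕ ↦ ((algebraMap ℚ_[p] ℂ_[p]).comp (algebraMap ℤ_[p] ℚ_[p]))
              (PowerSeries.coeff k ((w : IwasawaAlgebra p) *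
                katoMultiplier p c d₁ n₁ n₂ n₃ n₄
                  ((IwasawaCharacter.Psi p ℤ_[p] κ σc : (PowerSeries ℤ_[p])ˣ) : IwasawaAlgebra p)
                  ((IwasawaCharacter.Psi p ℤ_[p] κ σd : (PowerSeries ℤ_[p])ˣ) : IwasawaAlgebra p)
                  (A.primeFactors.erase p) (fun ℓ => W.LFunction ℓ) (fun ℓ => if ℓ ∣ NW then 0 else 1)
                  (fun ℓ => ((IwasawaCharacter.Psi p ℤ_[p] κ (σℓ ℓ) : (PowerSeries ℤ_[p])ˣ) : IwasawaAlgebra p)))) *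
              (ψ (cyclotomicGenerator p : ZMod (p ^ (n + 1))) - 1) ^ k) t →
          Kobayashi2003.padicGaussSumAt p (cycLevel p (n + 1) ∅) (ιp (cycLevel p (n + 1) ∅)) (ρ n)
              (DirichletCharacter.changeLevel (dvd_mul_right _ _ : p ^ (n + 1) ∣ cycLevel p (n + 1) ∅) ψ) *
            Kobayashi2003.padicCharSum p (cycLevel p (n + 1) ∅) (ιp (cycLevel p (n + 1) ∅))
              ((DirichletCharacter.changeLevel (dvd_mul_right _ _ : p ^ (n + 1) ∣ cycLevel p (n + 1) ∅) ψ) ^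
                (p ^ n - 1))
              (Λ (n + 1) ∅ (resLe (tateRep W p).toTopRep
                (hκ.cyclotomicLevelsRat_level_succ_le_layerSubgroup hp ∅ n) 1
                (levelToLayer W p hκ hp (badPlaces c d₁ A NW) n
                  (z (n + 1) (cyclotomicLevelsRat p (badPlaces c d₁ A NW)).idealOne)))) =
          C' * t * (if Even (p / 2) then ratTwistedSymbolSum f ψ else ratMinusTwistedSymbolSum f ψ) := by
  sorry

/-- RESEARCH stub 2c-T2 (v12; with stub 2c-T1 replaces v11's registered research stub 2c; v18: 2c-T1 is RESHAPED to 2c-T1″ `stub_twistScalarIstarZeroStd` and its letter is the sorry-free `zetaLinesProportionalIstarZero_closed`) — «THE TWIST EXPONENT IDENTITY `a = b`»: for every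
row, every `η`-frame, every pin `I`, every dual fine Selmer datum `FB₁`, every Kobayashi package `P₁` on `(I, FB₁)`, every ADMISSIBLE Kato class
`z₁` on `I` and all `a b : ℕ`: `(p : Λ)^a • P₁.z = (p : Λ)^b • z₁ → a = b` — Kobayashi's class of the twin and Kato's `Ω_W`-normalised class of
`W = V ⊗ η` agree up to `Λˣ` on the pin, with NO power of `p`: ONE INTEGER IDENTITY PER PIN (the difference `a − b` is determined by the pin:
torsion-freeness of `𝐇¹_Γ(T_pW)`, package rigidity `CccOnePackageRigidity` p827306 granted 19867, and ★ — two admissible classes differ by a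
unit).  Granted 19867 + ★ + GZK and stub 2c-T1, EQUIVALENT to v11's stub 2c (`CccOneAdmissiblePackage.stub2c_iff_exponent_eq`), hence to v10's
stub 2b on the rows; it is the `p`-adic valuation `0` of the twist-period / differential constant along `φ : V ≅ W` over `ℚ(√p*)` (hand -4's
`e = 0`; hand -5's DERIVATION-ZC b9e786570c6b1ea0: the factor `(p*)^{−1/2}` enters the de Rham and the period sides identically, no Gauss sum
survives in the ratio; hand -6: scaling invariance of Kato's normalisation).  Label RESEARCH: the integral comparison of Kato's element of a
TWIST at an additive prime with the twisted element is not in print (Burungale–Tian Rem. 2.7: «a finer analysis of [Kato, §15] is essential»;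
nearest print Burungale–Skinner–Tian–Wan 2024 §1.5 for `p ∤ disc`).  Why it might fail: a non-unit twist-period constant (a factor `p^{±1/2·2}`
from `Ω_V^± / Ω_{W}^∓·√p*` surviving on one parity of `p mod 4`) would make `a − b` a FIXED NON-ZERO integer on a whole row — the disprover's
target (predicted `0`). [cite: Kato2004Asterisque, Thm. 12.5 (1) (p. 221), Conj. 12.10 (p. 224), §14.9 (14.9.3) (p. 240)]
[cite: Kobayashi2003, Thm. 6.3 (p. 11), Thm. 7.3 i) (p. 13)] [cite: BurungaleTian2026, Rem. 2.7 (p. 5)]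
[cite: BurungaleSkinnerTianWan2024, §1.5 (pp. 18–21)] [cite: Washington1997, §13.2] -/
theorem stub_twistExponentEqIstarZero :
    ∀ (p : ℕ) [Fact p.Prime], 5 ≤ p → ∀ (W : WeierstrassCurve ℚ) [W.IsElliptic] [W.IsGloballyMinimal],
      HasSignedLocalType W p (.Istar 0) → W.analyticRank = 1 →
      letI : ContinuousSMul ℤ_[p] (W.tateModule p) := TateModule.continuousSMul_padicInt
      ∀ (K₀ : Type) [Field K₀] [NumberField K₀] [IsCyclotomicExtension {p} ℚ K₀] [(galRange (K := ℚ) K₀).Normal]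
        (η : Field.absoluteGaloisGroup ℚ →* ℤˣ), (∀ σ ∈ galRange (K := ℚ) K₀, η σ = 1) → η ≠ 1 →
      ∀ (V : WeierstrassCurve ℚ) [V.IsElliptic] [V.IsGloballyMinimal] {N : ℕ} [NeZero N]
        {f : CuspForm (CongruenceSubgroup.Gamma0 N) 2},
        V.HasCM → V.HasGoodReductionAtPrime p → V.frobeniusTrace p = 0 → ModularForms.IsNewformOf V f →
      ∀ (ϖ : ℚ), (if Even (p / 2) then (ϖ : ℝ) * V.realPeriodRat = ModularForms.plusPeriod f
          else (ϖ : ℝ) * V.imaginaryPeriodRat = ModularForms.minusPeriod f) →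
      ∀ (κ : ZpExtension ℚ p) (hκ : κ.IsCyclotomic) (γ : Field.absoluteGaloisGroup ℚ) (_ : κ.IsTopGenerator γ),
        γ ∈ galRange (K := ℚ) K₀ → IsCyclotomicVariable p γ →
      ∀ (C : VariableChange ℚ), C • W.quadraticTwist ((-1) ^ (p / 2) * p) = V →
      ∀ (I : IwasawaH1Data W p κ γ) (FB₁ : W.FineSelmerDualData κ γ)
        (P₁ : Kobayashi2003.EtaColemanPoitouTateData p K₀ η V f ϖ κ γ W I FB₁) (z₁ : I.H) (a b : ℕ),
        Kato2004.IsAdmissibleZetaClass W p κ hκ I z₁ →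
        ((p : IwasawaAlgebra p) ^ a) • P₁.z = ((p : IwasawaAlgebra p) ^ b) • z₁ → a = b := by
  sorry

/-- PRINT stub 5 (v18 = v12's eight conjuncts + the NINTH [A′] `Kobayashi2003.exists_colPlusInterpolationCoherent` (Literature
`Kobayashi2003/EtaColemanInterpolationCoherent.lean`, p837519: Kobayashi 2003 §8 read in ONE norm-coherent root system — the plus Coleman map interpolates
the `exp*`-character sums of EVERY class at the characters of `p`-power order and even level, Gauss sums at a root system on which the `p`-adic
embeddings are tame-coherent, one global scalar AND one `Λ`-unit; SUPERSEDES the quarantined zeta-frame [A] p834027, which is NOT a conjunct) + the TENTH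
[C-align] `Kato2004.exists_traceCoherentRootSystem_of_definedExpStarBody` (Literature `Kato2004/ExpStarCorestrictionRootSystem.lean`, p837332: Kato 2004
Thm. 12.5 / (C1)(C4) — a (DEF)-datum's `exp*`-frame carries a trace-coherent root system), both typed by k-ty1 g40 under director-bsd (993)(a)(iii),
pre-read pen D1215 / critic NOTEs #71–#72 / host eis l.8295–8297, tree +1 each booked at landing (pen D1217; the line's named-fact ledger 8 → 10),
appended LAST and consumed by the sorry-free `zetaLinesProportionalIstarZero_closed` [cite: Kobayashi2003, Cor. 8.20 (p. 21), §8.4 (p. 16), Prop.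
8.25–8.26, (8.29) (pp. 24–25)] [cite: Kato2004Asterisque, Thm. 12.5 (1) (p. 221)];
v12 = v11's seven conjuncts + the EIGHTH ★ `Kato2004.exists_zetaClassPosition_of_rank_le_one` (Literature
`Kato2004/ZetaClassOnRankLeOneBranch.lean`: on the rank-`≤ 1` branch of `𝐇¹_Γ(T_pW)`, `p` odd, a value-pinned admissible family is realised and
positioned against ONE element — Kato Thm. 12.5 (1)(2), §13.9 (p. 230 l. 8–9), Lemma 13.10 (1); Thm. 12.4 (2) read on the branch; already typed in the
tree: tree debt unchanged, the line's named-fact ledger 7 → 8), appended LAST and consumed by the sorry-free `muColPlusAdmissibleIstarZero_closed`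
[cite: Kato2004Asterisque, Thm. 12.5 (1)(2) (p. 221), §13.9 (pp. 229–230), Lemma 13.10 (1) (p. 230), Thm. 12.4 (2) (p. 221)]
[cite: RohrlichInventiones1984, Theorem p. 409]; v11 = v9's four conjuncts + THREE, all already typed in the tree (tree debt unchanged; the line's
named-fact ledger 4 → 7),
consumed by the sorry-free `katoMuEqualityIstarZero_closed`: FIFTH Mazur's `p ∤ c₀` for semistable-at-`p` optimal curves
`ModularForms.mazur_not_dvd_maninConstant_of_odd` (Literature `ManinConstantSemistablePrimewise.lean`; the period ratio `ϖ` of the twin via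
`Additive.periodRatio_of_mazur`) [cite: Mazur1978, Cor. 4.1]; SIXTH the route's named-fact item 19867 `PublishedInputsEtaUpToP` BY NAME (the two
published inputs of the up-to-μ plus main conjecture at η: Burungale–Tian Thm. 2.6 at η and Kobayashi's Thm. 2.2 / §4 μ-criterion inputs, as the
route file states them) [cite: BurungaleTian2026, Thm. 2.6 (p. 5)] [cite: Kobayashi2003, Thm. 2.2, §4 (p. 8)]; SEVENTH the Kobayashi package fact
`Kobayashi2003.thm62_63_73_etaColemanPoitouTate` (Literature `Kobayashi2003/EtaColemanPoitouTateSequences.lean`: Thm. 6.2 (6.13)/(6.15) + Thm. 6.3 +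
Thm. 7.3 i) (7.21) + Cor. 7.2 at η on pinned objects) [cite: Kobayashi2003, Thm. 6.2–6.3 (p. 11), Thm. 7.3 i), Cor. 7.2 (p. 13)];
v9 = v7 + the FOURTH conjunct BT26 `Kato2004.BurungaleTian2026_lengthEq_offMu_of_hasCM` (Literature p736588; Burungale–Tian,
Ann. of Math. 203 (2026) Thm. 2.6 = Kato's Conj. 12.10 in `Λ ⊗ ℚ` for CM newforms, every p; typed for CM W/ℚ, `p ≠ 2`, Δ-trivial component,
fine-Selmer currency; named-fact debt +1, planner D748) [cite: BurungaleTian2026, Thm. 2.6, Rem. 2.7 (p. 5)];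
v7 = v6 + the THIRD conjunct F-CM `Kato2004.exists_isAdmissibleZetaClass_of_hasCM_of_irreducible` (Literature p731776;
Kato Prop. 15.21 first part, PRINT-BY-PROOF at λ = p for CM W, p odd, p unramified in the CM field, W[p] irreducible; named-fact debt +1,
planner D724) [cite: Kato2004Asterisque, Prop. 15.21 (p. 266), proof p. 267 l. 5–6; §13.14 (p. 234); Lemma 14.7 (p. 238); Lemma 15.20 (p. 266)];
v6 = v5's three conjuncts minus `Kato2004.thm12_4`, whose rank-one content on the rows is PROVED
in-tree by E51–E55) — H2X′ `Kato2004.exists_iwasawaH2Data_fineSelmerDual_embedding_loc` (the `𝐇²`–fine-Selmer-dual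
embedding with its localisation clause, §13.9/(17.13.1); Literature p719171) and `ModularForms.exists_isNewformOf`
(modularity with level; Carayol's level input `IsNewformOf.level_eq_conductorNorm` is DERIVED from it in-tree), BY NAME.
Never a prover target here. [cite: Kato2004Asterisque, §13.9 (p. 230), (17.13.1) (p. 279)]
[cite: BreuilConradDiamondTaylor2001, Thm. A] [cite: DiamondShurman2005, Thm. 8.8.1, Thm. 8.8.3] -/
theorem stub_printFactsKato :
    Kato2004.exists_iwasawaH2Data_fineSelmerDual_embedding_loc ∧ ModularForms.exists_isNewformOf ∧
      Kato2004.exists_isAdmissibleZetaClass_of_hasCM_of_irreducible ∧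
        Kato2004.BurungaleTian2026_lengthEq_offMu_of_hasCM ∧
          ModularForms.mazur_not_dvd_maninConstant_of_odd ∧ PublishedInputsEtaUpToP ∧
            Kobayashi2003.thm62_63_73_etaColemanPoitouTate ∧ Kato2004.exists_zetaClassPosition_of_rank_le_one ∧
              Kobayashi2003.exists_colPlusInterpolationCoherent ∧
                Kato2004.exists_traceCoherentRootSystem_of_definedExpStarBody := by
  sorry

/-- ROUTE-CRUX stub 6a (v10; (T22) correction; v11: MOVED above its in-file consumer `katoMuEqualityIstarZero_closed`, text unchanged) — the route's crux `PlusMCEtaK` (item stmt-BirchSwinnertonDyer-19501: the signed/plus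
main conjecture for the CM form in the K_∞-form at η, BY NAME; ledger split: up-to-μ part 19866 CLOSED, μ-part 19865 RESEARCH).  Closes when
19501 closes; never restated here.  Why it might fail: its μ-part is open in print (Burungale–Tian Rem. 2.7 at η).
[cite: PollackRubin2004, Theorem (p. 448)] [cite: BurungaleTian2026, Thm. 2.6, Rem. 2.7 (p. 5)] [cite: Kobayashi2003, Thm. 2.2] -/
theorem stub_plusMCEtaK : PlusMCEtaK := by
  sorry

/-- PRINT stub 6b (v10; v12: MOVED above its in-file consumers (`hasPRRatioIstarZero_closed`, v14; `perrinRiouRatioIstarZero_closed`, v13; `muColPlusAdmissibleIstarZero_closed`), text unchanged; replaces v4–v9's `PrintReadingsInert ∧ PublishedFactsInert`, whose first conjunct is the ASIDE 19226 with the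
conjecture-grade (C1_η) inside — (T22)) — the route's named-fact item `SignedReadingFacts` (19502: Kitajima–Otsuki 2018 Main Thm. 1.3,
Kobayashi 2003 Thm. 7.4) and the rank part of Gross–Zagier–Kolyvagin, BY NAME; Poitou–Tate over ℚ is a THEOREM of the tree
(`…PoitouTateReduction.poitouTate_selmerStructure_duality_real_holds ℚ`, p626891) discharged inside E59's head ((T23)).  Never a prover
target here. [cite: KitajimaOtsuki2018, Main Thm. 1.3 (arXiv:1607.03612 p. 3)] [cite: Kobayashi2003, Thm. 7.4 (p. 13)] [cite: Darmon2004, Thm. 3.22] -/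
theorem stub_printInputsInert :
    SignedReadingFacts ∧ rank_eq_analyticRank_of_analyticRank_le_one := by
  sorry

/-- **CLOSED IN-FILE (v14) — v13's PRINT-BY-PROOF stub 1a ((E) realisability of a Perrin-Riou ratio of Kato's value-pinned zeta descent
datum at every rank-one pair of the type `(p, I₀*)`, `p ≥ 5`)**, TYPE = v13's `stub_hasPRRatioIstarZero` VERBATIM, by hand -7's
`CccOneHasPRRatio.hasPRRatioIstarZero_of_facts` (p831109) fed with F-CM (`stub_printFactsKato.2.2.1`) and GZK (`stub_printInputsInert.2`):
an admissible Kato class on a cyclotomic pin carries a Perrin-Riou ratio (the admissible body (A0)–(A4) is the `PRRatioBody` (Z0)–(Z5) verbatim),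
the Kummer-logarithm line by `LocPKummer.logEx_of_gzk`, the generator by Mordell–Weil at rank one.  No `sorry` here; named-fact debt +0.
[cite: Kato2004Asterisque, Thm. 12.5 (1) (p. 221), §13.9 (p. 230), §14.9 (14.9.3) (p. 240)] [cite: PerrinRiou1993AIF, §3.3]
[cite: BurnsKuriharaSano2019, §2.3, Conj. 2.8 (p. 10)] [cite: Darmon2004, Thm. 3.22] -/
theorem hasPRRatioIstarZero_closed :
    ∀ (p : ℕ) [Fact p.Prime], 5 ≤ p → ∀ (W : WeierstrassCurve ℚ) [W.IsElliptic] [W.IsGloballyMinimal],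
      HasSignedLocalType W p (.Istar 0) → W.analyticRank = 1 →
      ∃ ℒ : ℚ_[p], Kato2004.PRRatio W p ℒ :=
  CccOneHasPRRatio.hasPRRatioIstarZero_of_facts stub_printFactsKato.2.2.1 stub_printInputsInert.2

/-- **CLOSED IN-FILE (v18) MODULO PRINT ([A′], [C-align], F-CM) AND ONE PER-LEVEL BOOKKEEPING STUB (hC″) — the LETTER of v12–v17's PRINT-BY-PROOF stub
2c-T1 («the two zeta lines on the pin are `ℚ_pˣ·Λˣ`-proportional»)**, TYPE = v12–v17's `stub_zetaLinesProportionalIstarZero` VERBATIM (385 tokens), by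
k-ty1 g40's kernel closer `CccOneZetaLinesCoherent.stub2cT1_of_colPlusInterpolationCoherent` (F1″, p838712,
161eb093191c514d) fed with [A′] = `stub_printFactsKato.2.2.2.2.2.2.2.2.1` (p837519), [C-align] = `stub_printFactsKato.2.2.2.2.2.2.2.2.2` (p837332), F-CM =
`stub_printFactsKato.2.2.1` and the NEW [C]-BOOKKEEPING stub 2c-T1″ `stub_twistScalarIstarZeroStd` (= the closer's ONE named residue hC″, VERBATIM).
KERNEL (F1″ + W2 `Kato2004/FrameOffsetDescent.lean` p838339, theorems only): both zeta lines' `Col⁺`-images interpolate the same twisted values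
`L(f_V, ηχ, 1) = L(f_W, χ, 1)` in ONE coherent frame — the trace-coherent root system of Kato's (DEF)-frame ([C-align]) is carried to the ι-standard roots
by offsets that (C1)/(C4)/(C5) + Fourier inversion + Rohrlich-at-level (`PSRohrlichAtLevel.rohrlich_primePow_of_isNewformOf`, a tree THEOREM) make
coherent beyond a level `n₁`, hence ONE unit `U ∈ Λˣ`; the Φ-trick `(1+T)^{p^{n₁}} − 1` kills the finitely many low levels so that (W1)
`IwasawaAlgebra.exists_pow_smul_eq_of_values_proportional` (p835629) gives `(p^a)•P₁.z = (p^b)•z₁` after `colPlus_injective` and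
`Kato2004.IsAdmissibleZetaClass.units_smul`.  No `sorry` here; 2c-T1 is RESHAPED, not closed outright: its unproved content is now 2c-T1″ (per-level,
class-free typing debt). [cite: Kobayashi2003, Cor. 8.20 (p. 21), Prop. 8.25–8.26 (pp. 24–25)] [cite: Kato2004Asterisque, Thm. 12.5 (1) (p. 221)]
[cite: RohrlichInventiones1984, Theorem p. 409] -/
theorem zetaLinesProportionalIstarZero_closed :
    ∀ (p : ℕ) [Fact p.Prime], 5 ≤ p → ∀ (W : WeierstrassCurve ℚ) [W.IsElliptic] [W.IsGloballyMinimal],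
      HasSignedLocalType W p (.Istar 0) → W.analyticRank = 1 →
      letI : ContinuousSMul ℤ_[p] (W.tateModule p) := TateModule.continuousSMul_padicInt
      ∀ (K₀ : Type) [Field K₀] [NumberField K₀] [IsCyclotomicExtension {p} ℚ K₀] [(galRange (K := ℚ) K₀).Normal]
        (η : Field.absoluteGaloisGroup ℚ →* ℤˣ), (∀ σ ∈ galRange (K := ℚ) K₀, η σ = 1) → η ≠ 1 →
      ∀ (V : WeierstrassCurve ℚ) [V.IsElliptic] [V.IsGloballyMinimal] {N : ℕ} [NeZero N]
        {f : CuspForm (CongruenceSubgroup.Gamma0 N) 2},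
        V.HasCM → V.HasGoodReductionAtPrime p → V.frobeniusTrace p = 0 → ModularForms.IsNewformOf V f →
      ∀ (ϖ : ℚ), (if Even (p / 2) then (ϖ : ℝ) * V.realPeriodRat = ModularForms.plusPeriod f
          else (ϖ : ℝ) * V.imaginaryPeriodRat = ModularForms.minusPeriod f) →
      ∀ (κ : ZpExtension ℚ p) (hκ : κ.IsCyclotomic) (γ : Field.absoluteGaloisGroup ℚ) (_ : κ.IsTopGenerator γ),
        γ ∈ galRange (K := ℚ) K₀ → IsCyclotomicVariable p γ →
      ∀ (C : VariableChange ℚ), C • W.quadraticTwist ((-1) ^ (p / 2) * p) = V →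
      ∀ (I : IwasawaH1Data W p κ γ),
        ∃ (FB₁ : W.FineSelmerDualData κ γ) (P₁ : Kobayashi2003.EtaColemanPoitouTateData p K₀ η V f ϖ κ γ W I FB₁)
          (z₁ : I.H) (a b : ℕ), Kato2004.IsAdmissibleZetaClass W p κ hκ I z₁ ∧
            ((p : IwasawaAlgebra p) ^ a) • P₁.z = ((p : IwasawaAlgebra p) ^ b) • z₁ :=
  CccOneZetaLinesCoherent.stub2cT1_of_colPlusInterpolationCoherent stub_printFactsKato.2.2.2.2.2.2.2.2.1
    stub_printFactsKato.2.2.2.2.2.2.2.2.2 stub_printFactsKato.2.2.1 stub_twistScalarIstarZeroStd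

/-- **CLOSED IN-FILE (v12; v18: reads `zetaLinesProportionalIstarZero_closed` where v12–v17 read stub 2c-T1) — v11's RESEARCH stub 2c («μ(Col⁺(loc z₀)) = μ(L_p⁺(V, η, X))») from 2c-T1 + stub 2c-T2 + ★ + 19867 + GZK**,
TYPE = v11's `stub_muColPlusAdmissibleIstarZero` VERBATIM (refill hand leafhand-4 g0's STUCK GOAL).  Proof: GZK on the row (`stub_printInputsInert.2`:
Mordell–Weil rank one, `Ш(W)` finite, hence `rank_{ℤ_p} H¹(ℤ[1/p], T_pW) ≤ 1` by `LocPKummer.rank_integralH1_le_one`); the proportional pair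
`(P₁, z₁, a, b)` of stub 2c-T1 on the pin; `a = b` by stub 2c-T2; then hand -6's `CccOneAdmissiblePackage.stub2c_of_proportional_of_eq` (granted
19867 = `stub_printFactsKato.2.2.2.2.2.1` and ★ = `.2.2.2.2.2.2.2.1` (v18 path): a proportionality with EQUAL exponents is «ZC» at `P₁` by torsion-freeness, ★
moves it to every admissible `z₀`, package rigidity p827306 to every package `P`).  No `sorry` here.
[cite: Kato2004Asterisque, Thm. 12.4 (2) and Thm. 12.5 (1) (p. 221), §14.9 (14.9.3) (p. 240)] [cite: Kobayashi2003, Thm. 6.3 (p. 11), Thm. 7.3 i) (p. 13)]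
[cite: Darmon2004, Thm. 3.22] -/
theorem muColPlusAdmissibleIstarZero_closed :
    ∀ (p : ℕ) [Fact p.Prime], 5 ≤ p → ∀ (W : WeierstrassCurve ℚ) [W.IsElliptic] [W.IsGloballyMinimal],
      HasSignedLocalType W p (.Istar 0) → W.analyticRank = 1 →
      letI : ContinuousSMul ℤ_[p] (W.tateModule p) := TateModule.continuousSMul_padicInt
      ∀ (K₀ : Type) [Field K₀] [NumberField K₀] [IsCyclotomicExtension {p} ℚ K₀] [(galRange (K := ℚ) K₀).Normal]
        (η : Field.absoluteGaloisGroup ℚ →* ℤˣ), (∀ σ ∈ galRange (K := ℚ) K₀, η σ = 1) → η ≠ 1 →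
      ∀ (V : WeierstrassCurve ℚ) [V.IsElliptic] [V.IsGloballyMinimal] {N : ℕ} [NeZero N]
        {f : CuspForm (CongruenceSubgroup.Gamma0 N) 2},
        V.HasCM → V.HasGoodReductionAtPrime p → V.frobeniusTrace p = 0 → ModularForms.IsNewformOf V f →
      ∀ (ϖ : ℚ), (if Even (p / 2) then (ϖ : ℝ) * V.realPeriodRat = ModularForms.plusPeriod f
          else (ϖ : ℝ) * V.imaginaryPeriodRat = ModularForms.minusPeriod f) →
      ∀ (κ : ZpExtension ℚ p) (hκ : κ.IsCyclotomic) (γ : Field.absoluteGaloisGroup ℚ) (_ : κ.IsTopGenerator γ),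
        γ ∈ galRange (K := ℚ) K₀ → IsCyclotomicVariable p γ →
      ∀ (C : VariableChange ℚ), C • W.quadraticTwist ((-1) ^ (p / 2) * p) = V →
      ∀ (I : IwasawaH1Data W p κ γ) (FB : W.FineSelmerDualData κ γ)
        (P : Kobayashi2003.EtaColemanPoitouTateData p K₀ η V f ϖ κ γ W I FB)
        (z₀ : I.H), Kato2004.IsAdmissibleZetaClass W p κ hκ I z₀ →
        ∀ (𝔮 : PrimeSpectrum (IwasawaAlgebra p)), 𝔮.asIdeal = IwasawaAlgebra.augIdealP p →
          Module.lengthAt (IwasawaAlgebra p) (IwasawaAlgebra p ⧸ Ideal.span {P.colPlus z₀}) 𝔮 =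
            Module.lengthAt (IwasawaAlgebra p) (IwasawaAlgebra p ⧸ Ideal.span {P.colPlus P.z}) 𝔮 := by
  intro p _ hp5 W _ _ hTy hr K₀ _ _ _ _ η hη hη1 V _ _ N _ f hCM hgood hap hf ϖ hϖ κ hκ γ hγ hγK hvar C hC I FB P z₀ hz₀
    𝔮 h𝔮
  have hp2 : p ≠ 2 := by omega
  letI : ContinuousSMul ℤ_[p] (W.tateModule p) := TateModule.continuousSMul_padicInt
  -- the named inputs of the line: 19867, ★, GZK
  have hF : PublishedInputsEtaUpToP := stub_printFactsKato.2.2.2.2.2.1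
  have hstar : Kato2004.exists_zetaClassPosition_of_rank_le_one := stub_printFactsKato.2.2.2.2.2.2.2.1
  have hGZK : rank_eq_analyticRank_of_analyticRank_le_one := stub_printInputsInert.2
  -- GZK on the row: Mordell–Weil rank one and `Ш(W)` finite, hence `rank_{ℤ_p} H¹(ℤ[1/p], T_pW) ≤ 1`
  obtain ⟨hmw, hfinSha⟩ := hGZK W (by rw [hr])
  have hrk : W.mordellWeilRank = 1 := by rw [hmw, hr]
  haveI : Finite W.sha := hfinSha
  have hsha : Finite (AddCommGroup.primaryComponent W.sha p) := inferInstance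
  have hrank := LocPKummer.rank_integralH1_le_one W p κ hrk hsha
  -- 2c-T1 (v18: the sorry-free `zetaLinesProportionalIstarZero_closed`): a proportional pair on the pin; stub 2c-T2: equal exponents
  obtain ⟨FB₁, P₁, z₁, a, b, hz₁, hT1⟩ := zetaLinesProportionalIstarZero_closed p hp5 W hTy hr K₀ η hη hη1 V hCM hgood hap
    hf ϖ hϖ κ hκ γ hγ hγK hvar C hC I
  have hab : a = b := stub_twistExponentEqIstarZero p hp5 W hTy hr K₀ η hη hη1 V hCM hgood hap hf ϖ hϖ κ hκ γ hγ hγK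
    hvar C hC I FB₁ P₁ z₁ a b hz₁ hT1
  subst hab
  exact CccOneAdmissiblePackage.stub2c_of_proportional_of_eq hp2 K₀ η hη hη1 V hCM hgood hap hf ϖ hϖ κ γ hκ hγ hγK hvar
    W I hF hstar hrank P₁ hz₁ hT1 P hz₀ 𝔮 h𝔮

/-- **CLOSED IN-FILE (v11; v12 reads `muColPlusAdmissibleIstarZero_closed` where v11 read stub 2c) — v10's RESEARCH stub 2b (the μ-EQUALITY AT `(p)`) from stub 2c + stub 6a + print**, TYPE = v10's
`stub_katoMuEqualityIstarZero` VERBATIM (= the `hat` binder of p735452).  Proof: the `η`-frame of the row as in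
`CccOneMuDictionaryEta.exists_kobayashiClass_lengthAt_fine_eq_onType_IstarZero_of_plusMCEtaKMuPart` (twin, newform, Mazur's period ratio,
`ℚ(μ_p)`, `η`, `(κ, γ)`); stub 2b's keying `K = κ.unitTwist c` (`ZpExtension.IsCyclotomic.exists_eq_unitTwist_holds`); the Kobayashi package `P`
on the re-keyed pin (`stub_printFactsKato.2.2.2.2.2.2.1`, v12); stub 2b's sentence AT `P.z`
(`CccOneMuDictionaryEta.lengthAt_contra_fine_eq_lengthAt_quotient_unitTwist_of_plusMCEtaKMuPart`, granted 19867 = `.2.2.2.2.2.1` and 19865 ⟸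
`stub_plusMCEtaK`); `P.z ↦ z₀` by stub 2c (v12: the sorry-free `muColPlusAdmissibleIstarZero_closed`) through `CccOneCollinearMu.zcMu_iff_lengthAt_colPlus` (admissibility on the re-keyed pin:
`Kato2004.IsAdmissibleZetaClass.changeData`) and the two `changeData` invariances of `length_(p)`.  No `sorry` here.
[cite: Kobayashi2003, proof of Thm. 7.4 (p. 13)] [cite: Kato2004Asterisque, Conj. 12.10 (p. 224)] [cite: Washington1997, §13.2] -/
theorem katoMuEqualityIstarZero_closed :
    ∀ (p : ℕ) [Fact p.Prime], 5 ≤ p → ∀ (W : WeierstrassCurve ℚ) [W.IsElliptic] [W.IsGloballyMinimal],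
      HasSignedLocalType W p (.Istar 0) → W.analyticRank = 1 →
      letI : ContinuousSMul ℤ_[p] (W.tateModule p) := TateModule.continuousSMul_padicInt
      ∀ (K : ZpExtension ℚ p) (hK : K.IsCyclotomic) (γ : Field.absoluteGaloisGroup ℚ) (_ : K.IsTopGenerator γ)
        (I : IwasawaH1Data W p K γ) (z₀ : I.H), Kato2004.IsAdmissibleZetaClass W p K hK I z₀ →
        ∀ (Y : W.FineSelmerDualData K γ⁻¹) (𝔮 : PrimeSpectrum (IwasawaAlgebra p)), 𝔮.asIdeal.height = 1 →
          𝔮.asIdeal = IwasawaAlgebra.augIdealP p →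
          Module.lengthAt (IwasawaAlgebra p) Y.X 𝔮 =
            Module.lengthAt (IwasawaAlgebra p) (I.H ⧸ (IwasawaAlgebra p) ∙ z₀) 𝔮 := by
  intro p _ hp5 W _ _ hTy hr K hK γ₀ hγ₀ I z₀ hz₀ Y 𝔮 _ h𝔮
  letI : ContinuousSMul ℤ_[p] (W.tateModule p) := TateModule.continuousSMul_padicInt
  have hp2 : p ≠ 2 := by omega
  -- the named inputs of the line
  have hnf : ModularForms.exists_isNewformOf := stub_printFactsKato.2.1
  have hM : ModularForms.mazur_not_dvd_maninConstant_of_odd := stub_printFactsKato.2.2.2.2.1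
  have hF : PublishedInputsEtaUpToP := stub_printFactsKato.2.2.2.2.2.1
  have hT : Kobayashi2003.thm62_63_73_etaColemanPoitouTate := stub_printFactsKato.2.2.2.2.2.2.1
  -- 19501 (stub 6a) gives its μ-part 19865 pointwise (kernel μ-criterion, granted 19867)
  have hμ : PlusMCEtaKMuPart := by
    intro p' _ hp' K₀ _ _ _ _ η hη hη1 V _ _ N _ f hCM hgood hap hf ϖ hϖ κ γ hκ hγ hγK hvar Lp hLp D
    exact (PlusMCEtaKUpToMu.plusMCEtaK_iff_muInvariant_eq_of_burungaleTian hF.1 hF.2 p' hp' K₀ η hη hη1 V hCM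
      hgood hap hf ϖ hϖ κ γ hκ hγ hγK hvar Lp hLp D).mp
      (stub_plusMCEtaK p' hp' K₀ η hη hη1 V hCM hgood hap hf ϖ hϖ κ γ hκ hγ hγK hvar Lp hLp D)
  -- the CM good-supersingular twin, its newform (modularity), its period ratio (Mazur)
  obtain ⟨V, hVe, hVm, C, hC, hgood, hap, hCM, -, -⟩ :=
    exists_goodTwist_pStar_of_hasSignedLocalType_IstarZero W hTy hp5
  haveI : NeZero (V.conductorNorm ℤ) := ⟨(V.conductorNorm_pos_holds).ne'⟩
  obtain ⟨f, hf⟩ := hnf V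
  obtain ⟨ϖ, -, hϖ⟩ := periodRatio_of_mazur p hM hp5 V f hf hgood hap
  -- the η-frame: `K₀ = ℚ(μ_p)`, the quadratic `η`, a cyclotomic `(κ, γ)` on the cyclotomic variable inside `Gal(ℚ̄/K₀)`
  haveI : NeZero p := ⟨(Fact.out : p.Prime).ne_zero⟩
  haveI : IsCyclotomicExtension {p} ℚ (CyclotomicField p ℚ) := CyclotomicField.isCyclotomicExtension p ℚ
  haveI : (galRange (K := ℚ) (CyclotomicField p ℚ)).Normal := normal_galRange_cyclotomic p _
  obtain ⟨θ, η, -, -, -, hηK, hη1⟩ := SignedTwist.exists_theta_eta_cyclotomicField p hp2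
  obtain ⟨κ, hκ, γ₁, hγ₁, hγ₁c⟩ := exists_isCyclotomic_isTopGenerator_isCyclotomicVariable_holds p
  obtain ⟨γ, hγK, hγκ⟩ := kappa_surjOn_galRange_cyclotomic κ (CyclotomicField p ℚ) (κ γ₁)
  have hγ : κ.IsTopGenerator γ := by rw [ZpExtension.IsTopGenerator, hγκ]; exact hγ₁
  have hγγ : γ₁⁻¹ * γ ∈ κ.kerSubgroup := by
    rw [ZpExtension.mem_kerSubgroup, map_mul, map_inv, hγκ, inv_mul_cancel]
  have hγc : IsCyclotomicVariable p γ := SignedTwist.isCyclotomicVariable_of_inv_mul_mem_ker hκ hγγ hγ₁c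
  -- stub 2b's keying `K` is a unit twist of the frame's `κ`; the Kobayashi package on the re-keyed pin
  obtain ⟨c, rfl⟩ := ZpExtension.IsCyclotomic.exists_eq_unitTwist_holds hκ hK
  obtain ⟨FB⟩ := W.nonempty_fineSelmerDualData κ hγ
  obtain ⟨P⟩ := hT p (CyclotomicField p ℚ) η hηK hη1 V hp2 hgood hap hf ϖ hϖ κ γ hκ hγ hγK hγc W C hC
    (I.changeData κ c hγ₀ hγ) FB
  -- stub 2b's sentence AT Kobayashi's class `P.z`, in the keying `(κ.unitTwist c, γ₀)` (19867 + 19865)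
  have hPz := CccOneMuDictionaryEta.lengthAt_contra_fine_eq_lengthAt_quotient_unitTwist_of_plusMCEtaKMuPart hp2
    (CyclotomicField p ℚ) η hηK hη1 V hCM hgood hap hf ϖ hϖ κ γ hκ hγ hγK hγc W hF hμ c hγ₀ I FB P Y 𝔮 h𝔮
  -- the admissible class on the re-keyed pin, and the research input stub 2c «μ(Col⁺ z₀) = μ(Col⁺ P.z)»
  have hz₀' : IsAdmissibleZetaClass W p κ hκ (I.changeData κ c hγ₀ hγ)
      (show (I.changeData κ c hγ₀ hγ).H from z₀) :=
    IsAdmissibleZetaClass.changeData κ c I hγ₀ hγ hK hκ hz₀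
  have hcol := muColPlusAdmissibleIstarZero_closed p hp5 W hTy hr (CyclotomicField p ℚ) η hηK hη1 V hCM hgood hap hf
    ϖ hϖ κ hκ γ hγ hγK hγc C hC (I.changeData κ c hγ₀ hγ) FB P (show (I.changeData κ c hγ₀ hγ).H from z₀) hz₀' 𝔮 h𝔮
  have hzc := ((CccOneCollinearMu.zcMu_iff_lengthAt_colPlus P hγ hz₀' 𝔮 h𝔮).mpr hcol).symm
  -- read both quotients back in `I`'s own `Λ`-structure (`φ_c` fixes `(p)`)
  rw [CccOneMuDictionaryEta.lengthAt_quotient_span_changeData_eq_of_asIdeal_eq_augIdealP κ c I hγ₀ hγ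
      (show I.H from P.z) 𝔮 h𝔮,
    CccOneMuDictionaryEta.lengthAt_quotient_span_changeData_eq_of_asIdeal_eq_augIdealP κ c I hγ₀ hγ z₀ 𝔮 h𝔮] at hzc
  rw [hPz]
  exact hzc

/-- **CLOSED IN-FILE (v9) — v7's research stub 2 VERBATIM from the cite conjunct BT26 + the μ-stub**, by p737094
`StrictCount.katoLengthEquality_istarZero_of_fact_of_atMu` (the OFF-μ half from `Kato2004.BurungaleTian2026_lengthEq_offMu_of_hasCM`
= `stub_printFactsKato.2.2.2` through `katoLengthEqualityOffMu_istarZero_of_fact` — `W.HasCM` from the row binders, `p ≠ 2` from `5 ≤ p`;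
the AT-μ half = `stub_katoMuEqualityIstarZero`, v11: = the sorry-free `katoMuEqualityIstarZero_closed` and BT26 at `.2.2.2.1`; `by_cases` on
`𝔮.asIdeal = IwasawaAlgebra.augIdealP p` inside).  TYPE = v7's
`stub_katoLengthEqualityIstarZero` VERBATIM (= the `hlen` binder of p731778).  No `sorry` here. -/
theorem lengthEq_closed :
    ∀ (p : ℕ) [Fact p.Prime], 5 ≤ p → ∀ (W : WeierstrassCurve ℚ) [W.IsElliptic] [W.IsGloballyMinimal],
      HasSignedLocalType W p (.Istar 0) → W.analyticRank = 1 →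
      letI : ContinuousSMul ℤ_[p] (W.tateModule p) := TateModule.continuousSMul_padicInt
      ∀ (K : ZpExtension ℚ p) (hK : K.IsCyclotomic) (γ : Field.absoluteGaloisGroup ℚ) (_ : K.IsTopGenerator γ)
        (I : IwasawaH1Data W p K γ) (z₀ : I.H), Kato2004.IsAdmissibleZetaClass W p K hK I z₀ →
        ∀ (Y : W.FineSelmerDualData K γ⁻¹) (𝔮 : PrimeSpectrum (IwasawaAlgebra p)), 𝔮.asIdeal.height = 1 →
          Module.lengthAt (IwasawaAlgebra p) Y.X 𝔮 =
            Module.lengthAt (IwasawaAlgebra p) (I.H ⧸ (IwasawaAlgebra p) ∙ z₀) 𝔮 :=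
  StrictCount.katoLengthEquality_istarZero_of_fact_of_atMu stub_printFactsKato.2.2.2.1 katoMuEqualityIstarZero_closed

/-- **CLOSED IN-FILE (v7) — v6's research stub 2 ON THE ROWS from the cite conjunct F-CM + the length-equality stub**, by
p731778 `StrictCount.katoMainConjectureFineContra_istarZero_of_fact_of_lengths` (the ∃-conjunct: F-CM through the row lemma
`hasIrreducibleModPGaloisRep_of_hasSignedLocalType_IstarZero`, CM / `¬CMRamified` / `p ≠ 2` from the row binders, the pin by
`nonempty_iwasawaH1Data_holds`; the (∀)-conjunct: `lengthEq_closed`, v9 — F-CM now at `.2.2.1`).  TYPE = v6's `stub_katoMainConjectureFineIstarZero`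
VERBATIM.  No `sorry` here. -/
theorem kmcFine_closed :
    ∀ (p : ℕ) [Fact p.Prime], 5 ≤ p → ∀ (W : WeierstrassCurve ℚ) [W.IsElliptic] [W.IsGloballyMinimal],
      HasSignedLocalType W p (.Istar 0) → W.analyticRank = 1 → KatoMainConjectureFineContra W p :=
  StrictCount.katoMainConjectureFineContra_istarZero_of_fact_of_lengths stub_printFactsKato.2.2.1
    lengthEq_closed

/-- **CLOSED IN-FILE (v13; v14: reads `hasPRRatioIstarZero_closed` for (E); v15: MOVED below `kmcFine_closed` and reads p831315's (NV) theorem where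
v13/v14 read `(stub 1b).1`) — v4–v12's RESEARCH stub 1 (PR^× on the rows)** from (E) + (NV) + stub 1b′ + modularity + GZK, TYPE = v12's
`stub_perrinRiouRatioIstarZero` VERBATIM, by hand -6's `CccOnePerrinRiouSplit.perrinRiouUpToUnitAt_iff_exists_and_forall_onType_IstarZero` (`←`;
PR-INV makes (NV)/(VAL) statements about THE ratio); (NV) on each row by hand -7's `CccOneHasPRRatio.perrinRiouNonvanishingIstarZero_of_kmcFineContra`
(H2X′ `stub_printFactsKato.1`, modularity `.2.1`, GZK `stub_printInputsInert.2`) fed with the line's sorry-free `kmcFine_closed` on that row.  No `sorry`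
here. [cite: BurnsKuriharaSano2019, Conj. 2.8 (i)–(ii) (p. 10), Thm. 7.6 (p. 29)] [cite: Kato2004Asterisque, Conj. 12.10 (p. 224), Thm. 12.5 (1) (p. 221), §13.9 (p. 230)]
[cite: Darmon2004, Thm. 3.22] -/
theorem perrinRiouRatioIstarZero_closed :
    ∀ (p : ℕ) [Fact p.Prime], 5 ≤ p → ∀ (W : WeierstrassCurve ℚ) [W.IsElliptic] [W.IsGloballyMinimal],
      HasSignedLocalType W p (.Istar 0) → W.analyticRank = 1 →
      PerrinRiouUpToUnitAt Kato2004.PRRatio W p :=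
  (CccOnePerrinRiouSplit.perrinRiouUpToUnitAt_iff_exists_and_forall_onType_IstarZero stub_printFactsKato.2.1
      stub_printInputsInert.2).mpr
    ⟨hasPRRatioIstarZero_closed,
      fun p _ hp W _ _ hT hr ℒ hℒ =>
        CccOneHasPRRatio.perrinRiouNonvanishingIstarZero_of_kmcFineContra stub_printFactsKato.1 stub_printFactsKato.2.1
          stub_printInputsInert.2 p hp W hT hr (kmcFine_closed p hp W hT hr) ℒ hℒ,
      stub_perrinRiouValuationIstarZero⟩

/-- **CLOSED IN-FILE (v6) — v4's PRINT stub 3 ON THE ROWS, GZK-guarded**: the rank-one count reading through the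
Perrin-Riou ratio at the print-exact closed triple, for the rank-one pairs of the signed type `(p, I₀*)`, `p ≥ 5` (row bsd-cm-8-p1's pairs), from
`stub_printFactsKato` by E53 `StrictCount.rankOneCountReading_istarZero_of_loc_of_modularity` (p726433; v5 used E48/E49 `…_of_modularity` with
Kato Thm. 12.4 BY NAME — its rank-one input is now PROVED from H2X′'s loc clause and modularity by E51/E52;
(14.9.3)/§14.14/Prop. 14.16 + H2X′ + Carayol; GZK is supplied by the composition head from the crux's own inputs).  v4's GENERIC
`stub_rankOneCountReadingKato : TorsionFree.RankOneCountReading …` (all torsion-free members) is NOT claimed and is no longer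
in the skeleton: the composition needs the count only on the rows (planner D674/D679).  No `sorry` here. -/
theorem rowCount_closed :
    rank_eq_analyticRank_of_analyticRank_le_one →
      ∀ (p : ℕ) [Fact p.Prime], 5 ≤ p → ∀ (W : WeierstrassCurve ℚ) [W.IsElliptic] [W.IsGloballyMinimal],
      HasSignedLocalType W p (.Istar 0) → W.analyticRank = 1 →
      ∀ (D : KatoDescentDatum p) (ℒ : ℚ_[p]),
        IsKatoZetaDescentDatumOfContra W p D → Kato2004.PRRatio W p ℒ →
        Finite (coinvariants p D.H2) ∧ (ℒ ≠ 0 ↔ D.zetaIndex ≠ 0) ∧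
          ∀ m : ℕ, D.zetaIndex = p ^ m * D.h2Card →
            ℒ.valuation = (m : ℤ) +
              padicValNat p (Nat.card (AddCommGroup.primaryComponent W.sha p)) +
              padicValNat p W.tamagawaProduct :=
  fun hGZK ↦ StrictCount.rankOneCountReading_istarZero_of_loc_of_modularity hGZK stub_printFactsKato.2.1 stub_printFactsKato.1

/-- **CLOSED IN-FILE (v6) — stub 4 ON THE ROWS, GZK-guarded** (realisability of a Kato descent datum of the print-exact
contragredient key at every row member where Kato's Main Conjecture holds) from H2X′ ALONE by E54
`StrictCount.realizableIstarZeroOfGZK_of_loc` (p725830; Kato Thm. 12.5 / §14.14 with the rank-one finiteness input PROVED in-tree by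
E51/E52; the (H2) pin from H2X′).  v5's GENERIC `TorsionFree.RealizableOfKMC IsKatoZetaDescentDatumOfContra
KatoMainConjectureFineContra` (all torsion-free members; needed `Kato2004.thm12_4`) is NOT claimed and is no longer in the
skeleton: E55's composition head needs realisability only on the rows.  No `sorry` here. -/
theorem realizable_closed :
    rank_eq_analyticRank_of_analyticRank_le_one →
      ∀ (p : ℕ) [Fact p.Prime], 5 ≤ p → ∀ (W : WeierstrassCurve ℚ) [W.IsElliptic] [W.IsGloballyMinimal],
      HasSignedLocalType W p (.Istar 0) → W.analyticRank = 1 →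
      KatoMainConjectureFineContra W p → ∃ D : KatoDescentDatum p, IsKatoZetaDescentDatumOfContra W p D :=
  StrictCount.realizableIstarZeroOfGZK_of_loc stub_printFactsKato.1

/-- **Composition (v18 = v17 = v15 = v14 = v13 BYTE-IDENTICAL head: reads `perrinRiouRatioIstarZero_closed` where v4–v12 read stub 1, otherwise v10's head; v10 = v9 re-keyed to the route of record, Poitou–Tate discharged) — the crux BY NAME from the six stubs (v14; seven in v13, six in v12, five in v4–v11)** via E59's
GZK-guarded, ROW-REALISED head on the route's rev-4 items (= E58 p739176 §2 at `hPT := …poitouTate_selmerStructure_duality_real_holds ℚ`)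
`KMCImpReadingPointwise.cccOneLawOnTypeIstarZero_of_rowCountOfGZK_of_rowRealizableOfGZK_of_kmcFineContra_of_perrinRiouRatio_of_plusMCEtaK_real`
(per pair: pointwise descent `rankOne_missingPPartAt_of_countAt` = BKS Thm. 7.6 at r = 1, `bsdp_of_missingPPartAt`, then the (K)-form converse
`CccOneKFormConverse.cccOneLawOnTypeIstarZero_of_bsdpOnType_of_plusMCEtaK`; the `→`-only reading discharged by the kernel lemma
`conj1210_of_isKatoZetaDescentDatumOfContra_of_katoMainConjectureFineContra`, p628155).  No `sorry` here. -/
theorem CccOneLawOnTypeIstarZero_of :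
    Summit.BirchSwinnertonDyer.BirchSwinnertonDyer.Theses.InertBadSignedBranches.CccOneLawOnTypeIstarZero :=
  KMCImpReadingPointwise.cccOneLawOnTypeIstarZero_of_rowCountOfGZK_of_rowRealizableOfGZK_of_kmcFineContra_of_perrinRiouRatio_of_plusMCEtaK_real
    rowCount_closed realizable_closed
    (fun p _ hp W _ _ hT hr => kmcFine_closed p hp W hT hr)
    (fun p _ hp W _ _ hT hr => perrinRiouRatioIstarZero_closed p hp W hT hr)
    stub_plusMCEtaK stub_printInputsInert.1 stub_printFactsKato.2.1 stub_printInputsInert.2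

end Summit.BirchSwinnertonDyer.BirchSwinnertonDyer.Cruxes.CccOneLawOnTypeIstarZero.KatoPerrinRiouIstar
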